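import Literature.Probability.RandomPlanarGeometry.HexSAWStripThresholdPointwise
import Literature.Probability.RandomPlanarGeometry.HexSAWStripBridgeKernelCesaro
import HarnessLib

/-!
# The renewal split of the β-walks of the honeycomb strip: a head, a horizontal bridge and a tail, glued at the first and the
# last renewal point — and the coefficients `β_{T,L,m}` of `B_{T,L}(x_c; y)` against it (module «BETA-SPLIT»)

Topic `Literature/Probability/RandomPlanarGeometry` (continues `HexSAWStripBridgeRenewal.lean` — renewal indices `HV.IsRenewalIdx`,
`HV.renIdxs`, the first renewal index `HV.fIdx` with `HV.fstP`/`HV.sndP`, translate-and-append `HV.hcat`, the level classes `HV.HBab`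
of standard horizontal Duminil-Copin–Hammond bridges; `HexSAWStripBridgeDecomposition.lean` — `HV.caseA`/`HV.caseB`, the mirror, `HV.sIdx`/`HV.tIdx`;
`HexSAWStripThresholdPointwise.lean` — `HV.stripBcoeffY_eq_sum_bridgeLists`, `HV.sum_caseB_slice_le`, `HV.topCnt_tail_xstd`;
`HexSAWStripBridgeKernelCesaro.lean` — the contact coefficients `HV.hbCoeffN`).  Sources of the SETTING: H. Duminil-Copin, A. Hammond,
CMP 324 (2013) §2.2 (bridges `ω₁(0) < ω₁(i) ≤ ω₁(n)`, renewal points, "γ[0,i] and γ[i,n] are bridges", concatenation, unique decomposition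
into irreducible bridges — here along the column `ξ` of the width-`T` honeycomb strip); H. Duminil-Copin, S. Smirnov, Ann. Math. 175
(2012) §3 (the domains `S_{T,L}` and their walks `a → β`); N. R. Beaton, M. Bousquet-Mélou, J. de Gier, H. Duminil-Copin, A. J. Guttmann,
CMP 326 (2014) §3.2 (`B_{T,L}(x; y) = Σ_m β_{T,L,m} y^m`, contacts with the top wall).  None of the sources writes the renewal split
of the β-walks; the statements are the lane's own (lane «pcv-sawmu», a-p2 g20) — the combinatorial half of the residue / coefficient
law of the PRINTED series `B_T(x_c; ·)` at `y_T`.  MATHS NOTE (correction to the lane's blueprint HANDOFF-gen19 (A), agreed by the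
labels desk): β-walks of case B (`tIdx < sIdx`) never have a renewal index and mirror case A, so the class of ALL β-walks without renewal
index is NOT summable at `y_T`; the renewal split lives on case A and `β_{T,L,m} = 2 · Σ_{case A}` (`stripBcoeffY_eq_two_mul_caseA`).

## What is proved (namespace `Literature.Probability.RandomPlanarGeometry.SAW.HV`; `x_c = hexCriticalFugacity`)

* §1 `IsRMax` (all columns `≤` the last), `IsLMin` (all later columns `>` the head's), `isHBridge_iff_isLMin_and_isRMax`, index forms;
  ★ `split_take_spec` / ★ `split_drop_spec` — splitting at ANY renewal index `i`: the prefix `l[0..i]` is `IsRMax`, the suffix `l[i..]` is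
  `IsLMin`, and the renewal indices below / above `i` are exactly those of the prefix / of the suffix; `sIdx_lt_tIdx_of_isRenewalIdx`
  (a walk with a renewal index is of case A).
* §2 ★★ `glue_spec` — THE GLUE LEMMA: for `p` `IsRMax` and `q` `IsLMin` standard of matching level (both `≥ 2` vertices), `hcat p q` has
  prefix `p`, suffix the translate of `q` from index `|p| − 1`, and `|p| − 1` IS A RENEWAL INDEX; chain / self-avoiding / in the strip when
  the pieces are; `isRMax_glue`; translation / prefix / suffix stability of `IsRMax`, `IsLMin`.
* §3 `lIdx` (the LAST renewal index), `midPc l = xstd l[f..ℓ]`, `tailPc l = xstd l[ℓ..]`; `threePieces_lengths`, ★ `fstP_append_mid_append_tail`,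
  `threePieces_weights` (length and contacts are additive), `threePieces_ends`, ★★ `glue_threePieces : hcat (hcat (fstP l) (midPc l)) (tailPc l) = l`,
  ★ `threePieces_injOn`, ★ `threePieces_props` (head `IsRMax` without renewal index; tail `IsLMin` without renewal index; middle a standard
  horizontal bridge, possibly trivial), `threePieces_levels`.
* §4 the classes: `renA T L` (β-walks of `S_{T,L}` with a renewal index; `renA_subset_caseA`, `renA_eq_filter_caseA`), `headN T N c`,
  `tailN T N e`, `HB0 T N c e` (all standard bridges `c → e`, the trivial one included); ★ `fstP_mem_headN`, ★ `tailPc_mem_tailN`,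
  ★ `midPc_mem_HB0`, `length_topCnt_threePieces`.
* §5 `glue3 h b g = hcat (hcat h b) g`; ★ `isRenewalIdx_hcat_iff` (renewal indices of a glued list), ★★ `glue3_spec` — gluing `h ∈ headN T N c`,
  `b ∈ HB0 T N' c e`, `g ∈ tailN T N e` gives a self-avoiding chain of `S_T` from the origin to the top with a renewal index whose split
  RETURNS `(h, b, g)`; `mem_bridgeLists_of_inLev`; ★ `glue3_mem_renA` (`2N + N' ≤ L`).  So the split is a BIJECTION onto the triples.
* §6 coefficient functions `headCoeffN` (`f^{(N)}_c(i)`), `hb0CoeffN` (`d⁰^{(N)}_{ce}(j)`), `tailCoeffN` (`g^{(N)}_e(k)`), the type `rtype`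
  and `renACoeff`; ★★ `renACoeff_le_prod` (upper, `N + 1 ≥ |V(S_{T,L})|`) and ★★ `prod_le_renACoeff` (lower, `2N + N' ≤ L`), type by type.
* §7 `T3`, `rtypes`, `sum_T3`, `sum_rtypes`, ★ `sum_renA_slice_eq_sum_rtypes` (fibre decomposition), ★ `sum_caseA_slice_le_caseB` and
  ★ `stripBcoeffY_eq_two_mul_caseA` (`β_{T,L,m} = 2·Σ_{case A}`), `sum_caseA_slice_eq`, and THE RENEWAL SPLIT OF THE COEFFICIENTS:
  ★★★ `stripBcoeffY_le_renewal` — `β_{T,L,m} ≤ 2·(Σ_{N₀^A, m contacts} x_c^{|ω|} + Σ_{c,e} Σ_{i+j+k=m} f^{(N)}_c(i) d⁰^{(N)}_{ce}(j) g^{(N)}_e(k))`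
  for `N + 1 ≥ |V(S_{T,L})|`, and ★★★ `renewal_le_stripBcoeffY` — `2·Σ_{c,e} Σ_{i+j+k=m} f^{(N)}_c(i) d⁰^{(N')}_{ce}(j) g^{(N)}_e(k) ≤ β_{T,L,m}`
  for `2N + N' ≤ L` (every `T ≥ 1`).
NOT claimed here: summability of the head / tail classes at `y_T`, the residue or the coefficient law of `B_T(x_c; ·)` (next module),
anything for `T = 0`.
-/

noncomputable section

open Finset Literature.Probability.LatticeModels Literature.Probability.Percolation

namespace Literature.Probability.RandomPlanarGeometry.SAW

namespace HV

/-! ### §1 Splitting a list at ANY renewal index -/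

section SplitAt

variable {l : List HV} {i : ℕ}

/-- Every vertex lies weakly LEFT of the last vertex (all columns `≤` the last column). [cite: DuminilCopinHammond2013, §2.2 ("ω₁(i) ≤ ω₁(n)": the right half of the bridge condition)] -/
def IsRMax (l : List HV) : Prop := ∃ h : l ≠ [], ∀ v ∈ l, xi v ≤ xi (l.getLast h)

/-- Every vertex after the head lies strictly RIGHT of the head (columns `>` the head column). [cite: DuminilCopinHammond2013, §2.2 ("ω₁(0) < ω₁(i)": the left half of the bridge condition)] -/
def IsLMin (l : List HV) : Prop := ∃ h : l ≠ [], ∀ v ∈ l.tail, xi (l.head h) < xi v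

/-- Decidability of `IsRMax` (plumbing). [folklore] -/
instance (l : List HV) : Decidable (IsRMax l) := by unfold IsRMax; infer_instance

/-- Decidability of `IsLMin` (plumbing). [folklore] -/
instance (l : List HV) : Decidable (IsLMin l) := by unfold IsLMin; infer_instance

/-- A horizontal bridge is exactly a list that is both `IsLMin` and `IsRMax`. [cite: DuminilCopinHammond2013, §2.2 (bridges: ω₁(0) < ω₁(i) ≤ ω₁(n))] -/
theorem isHBridge_iff_isLMin_and_isRMax : IsHBridge l ↔ IsLMin l ∧ IsRMax l := by
  constructor
  · rintro ⟨hne, hb⟩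
    refine ⟨⟨hne, fun v hv => (hb v hv).1⟩, ⟨hne, fun v hv => ?_⟩⟩
    obtain ⟨x, t, rfl⟩ := List.exists_cons_of_ne_nil hne
    rcases List.mem_cons.1 hv with rfl | hv''
    · rcases t with _ | ⟨w, t'⟩
      · simp
      · have := hb w (by simp)
        simp only [List.head_cons] at this
        linarith [this.1, this.2]
    · exact (hb v hv'').2
  · rintro ⟨⟨hne, h1⟩, ⟨hne', h2⟩⟩
    exact ⟨hne, fun v hv => ⟨h1 v hv, h2 v (List.tail_subset _ hv)⟩⟩

/-- `IsRMax` in index form. [cite: DuminilCopinHammond2013, §2.2; lane plumbing] -/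
theorem isRMax_iff_xiAt : IsRMax l ↔ l ≠ [] ∧ ∀ j, j < l.length → xiAt l j ≤ xiAt l (l.length - 1) := by
  constructor
  · rintro ⟨hne, h⟩
    refine ⟨hne, fun j hj => ?_⟩
    rw [xiAt_eq_xi_getElem hj, xiAt_eq_xi_getElem (by have := List.length_pos_of_ne_nil hne; omega), ← List.getLast_eq_getElem hne]
    exact h _ (List.getElem_mem hj)
  · rintro ⟨hne, h⟩
    refine ⟨hne, fun v hv => ?_⟩
    obtain ⟨j, hj, rfl⟩ := List.mem_iff_getElem.1 hv
    rw [List.getLast_eq_getElem hne, ← xiAt_eq_xi_getElem hj, ← xiAt_eq_xi_getElem]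
    exact h j hj

/-- `IsLMin` in index form. [cite: DuminilCopinHammond2013, §2.2; lane plumbing] -/
theorem isLMin_iff_xiAt : IsLMin l ↔ l ≠ [] ∧ ∀ j, 0 < j → j < l.length → xiAt l 0 < xiAt l j := by
  constructor
  · rintro ⟨hne, h⟩
    refine ⟨hne, fun j hj0 hj => ?_⟩
    rw [xiAt_eq_xi_getElem hj, xiAt_eq_xi_getElem (List.length_pos_of_ne_nil hne), ← List.head_eq_getElem hne]
    exact h _ (by rw [← List.drop_one, List.mem_drop_iff_getElem]; exact ⟨j - 1, by omega, by congr 1; omega⟩)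
  · rintro ⟨hne, h⟩
    refine ⟨hne, fun v hv => ?_⟩
    rw [← List.drop_one, List.mem_drop_iff_getElem] at hv
    obtain ⟨j, hj, rfl⟩ := hv
    rw [List.head_eq_getElem hne, ← xiAt_eq_xi_getElem, ← xiAt_eq_xi_getElem]
    exact h (1 + j) (by omega) (by omega)

/-- ★ **Split at a renewal index, part 1: the prefix.**  If `i` is a renewal index of `l`, the prefix `l.take (i+1)` has length
`i + 1 ≥ 2`, is `IsRMax`, and for `j < i`: `j` is a renewal index of `l` iff it is one of the prefix.
[cite: DuminilCopinHammond2013, §2.2 ("γ[0,i] and γ[i,n] are bridges"; renewal points of the pieces)] -/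
theorem split_take_spec (hi : IsRenewalIdx l i) :
    (l.take (i + 1)).length = i + 1 ∧ IsRMax (l.take (i + 1)) ∧
      ∀ j, j < i → (IsRenewalIdx l j ↔ IsRenewalIdx (l.take (i + 1)) j) := by
  obtain ⟨hi0, hi1, hle, hlt⟩ := hi
  have hlen : (l.take (i + 1)).length = i + 1 := by rw [List.length_take]; omega
  have hxi : ∀ j, j < i + 1 → xiAt (l.take (i + 1)) j = xiAt l j := fun j hj => xiAt_take hj
  refine ⟨hlen, ?_, fun j hji => ?_⟩
  · rw [isRMax_iff_xiAt, hlen, Nat.add_sub_cancel]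
    refine ⟨List.ne_nil_of_length_pos (by rw [hlen]; omega), fun j hj => ?_⟩
    rw [hxi j hj, hxi i (by omega)]
    exact hle j (mem_range.2 hj)
  · constructor
    · rintro ⟨h0, h1, h2, h3⟩
      refine ⟨h0, by rw [hlen]; omega, fun k hk => ?_, fun k hk hjk => ?_⟩
      · rw [mem_range] at hk
        rw [hxi k (by omega), hxi j (by omega)]; exact h2 k (mem_range.2 hk)
      · rw [mem_range, hlen] at hk
        rw [hxi k hk, hxi j (by omega)]; exact h3 k (mem_range.2 (by omega)) hjk
    · rintro ⟨h0, h1, h2, h3⟩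
      rw [hlen] at h1 h3
      refine ⟨h0, by omega, fun k hk => ?_, fun k hk hjk => ?_⟩
      · rw [mem_range] at hk
        have := h2 k (mem_range.2 hk)
        rwa [hxi k (by omega), hxi j (by omega)] at this
      · rw [mem_range] at hk
        by_cases hki : k ≤ i
        · have := h3 k (mem_range.2 (by omega)) hjk
          rwa [hxi k (by omega), hxi j (by omega)] at this
        · -- beyond the prefix: `ξ_j ≤ ξ_i < ξ_k`
          have a1 : xiAt l j ≤ xiAt l i := hle j (mem_range.2 (by omega))
          have a2 := hlt k (mem_range.2 hk) (by omega)
          linarith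

/-- ★ **Split at a renewal index, part 2: the suffix.**  If `i` is a renewal index of `l`, the suffix `l.drop i` has length
`|l| − i ≥ 2`, is `IsLMin`, and for `j ≥ 1`: `i + j` is a renewal index of `l` iff `j` is one of the suffix; the index `0` of the
suffix is never a renewal index. [cite: DuminilCopinHammond2013, §2.2 ("γ[0,i] and γ[i,n] are bridges"; renewal points of the pieces)] -/
theorem split_drop_spec (hi : IsRenewalIdx l i) :
    (l.drop i).length = l.length - i ∧ IsLMin (l.drop i) ∧
      (∀ j, IsRenewalIdx (l.drop i) j ↔ 0 < j ∧ IsRenewalIdx l (i + j)) := by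
  obtain ⟨hi0, hi1, hle, hlt⟩ := hi
  have hlen : (l.drop i).length = l.length - i := List.length_drop
  have hxi : ∀ j, xiAt (l.drop i) j = xiAt l (i + j) := fun j => xiAt_drop i j
  refine ⟨hlen, ?_, fun j => ?_⟩
  · rw [isLMin_iff_xiAt, hlen]
    refine ⟨List.ne_nil_of_length_pos (by rw [hlen]; omega), fun j hj0 hj => ?_⟩
    rw [hxi, hxi, Nat.add_zero]
    exact hlt (i + j) (mem_range.2 (by omega)) (by omega)
  · unfold IsRenewalIdx
    rw [hlen]
    simp only [mem_range, hxi]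
    constructor
    · rintro ⟨h0, h1, h2, h3⟩
      refine ⟨h0, by omega, by omega, fun k hk => ?_, fun k hk hik => ?_⟩
      · by_cases hki : k ≤ i
        · have a1 := hle k (mem_range.2 (by omega))
          have a2 := hlt (i + j) (mem_range.2 (by omega)) (by omega)
          linarith
        · have := h2 (k - i) (by omega)
          rwa [show i + (k - i) = k by omega] at this
      · have := h3 (k - i) (by omega) (by omega)
        rwa [show i + (k - i) = k by omega] at this
    · rintro ⟨hj, h0, h1, h2, h3⟩
      exact ⟨hj, by omega, fun k hk => h2 (i + k) (by omega), fun k hk hjk => h3 (i + k) (by omega) (by omega)⟩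

/-- A list with a renewal index has `sIdx < tIdx` (its last leftmost visit precedes its last rightmost visit): every minimal-column
index is `≤ i` and every maximal-column index is `> i`. [cite: DuminilCopinHammond2013, §2.2 (renewal points); lane plumbing] -/
theorem sIdx_lt_tIdx_of_isRenewalIdx (hi : IsRenewalIdx l i) : sIdx l < tIdx l := by
  obtain ⟨hi0, hi1, hle, hlt⟩ := hi
  have hl : l ≠ [] := List.ne_nil_of_length_pos (by omega)
  obtain ⟨hsl, hmin, -⟩ := sIdx_spec hl
  obtain ⟨htl, hmax, -⟩ := tIdx_spec hl
  have h1 : sIdx l ≤ i := by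
    by_contra h
    have a := hlt (sIdx l) (mem_range.2 hsl) (by omega)
    have b := hmin i (by omega)
    omega
  have h2 : i < tIdx l := by
    by_contra h
    have a := hle (tIdx l) (mem_range.2 (by omega))
    have b := hmax (i + 1) (by omega)
    have c := hlt (i + 1) (mem_range.2 (by omega)) (by omega)
    omega
  omega

end SplitAt

/-! ### §2 Gluing: a left-maximal list followed by a right-minimal standard list of matching level -/

section Glue

variable {T : ℕ} {p q : List HV}

/-- ★ **The glue lemma.**  Let `p` be `IsRMax` and `q` be `IsLMin` with standard head (`x₀ = 0`), both with at least two vertices, and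
`lev (last p) = lev (head q)`.  Then `hcat p q = p ++ (translate of q).tail` has `|p| + |q| − 1` vertices, `p` as its prefix, the translate
of `q` as its suffix from index `|p| − 1`, and `|p| − 1` IS A RENEWAL INDEX; it is a lattice chain / self-avoiding / in the levels of the strip
when `p` and `q` are (the columns of `p` are `≤ ξ(last p) <` the columns of the appended part).
[cite: DuminilCopinHammond2013, §2.2 (concatenation of bridges at a renewal point); lane «pcv-sawmu» a-p2 g20] -/
theorem glue_spec (hpR : IsRMax p) (hp2 : 2 ≤ p.length) (hqL : IsLMin q) (hq2 : 2 ≤ q.length)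
    (hq0 : ∀ hq : q ≠ [], (q.head hq).1 = 0) (hlev : ∀ (hp : p ≠ []) (hq : q ≠ []), lev (p.getLast hp) = lev (q.head hq)) :
    (hcat p q).length = p.length + q.length - 1 ∧
    (hcat p q).take p.length = p ∧
    (hcat p q).drop (p.length - 1) = q.map (shift (p.getLast?.getD hvOrigin).1 0) ∧
    IsRenewalIdx (hcat p q) (p.length - 1) ∧
    (hcat p q).head? = p.head? ∧
    (∀ hne (hq : q ≠ []), (hcat p q).getLast hne = shift (p.getLast?.getD hvOrigin).1 0 (q.getLast hq)) ∧
    (p.IsChain hvGraph.Adj → q.IsChain hvGraph.Adj → (hcat p q).IsChain hvGraph.Adj) ∧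
    (p.Nodup → q.Nodup → (hcat p q).Nodup) ∧
    (InLev T p → InLev T q → InLev T (hcat p q)) := by
  have hp : p ≠ [] := List.ne_nil_of_length_pos (by omega)
  have hq : q ≠ [] := List.ne_nil_of_length_pos (by omega)
  obtain ⟨hp', hpb⟩ := hpR
  obtain ⟨hq', hqb⟩ := hqL
  have hu0' := shift_head_eq_getLast hp hq (hq0 hq) (hlev hp hq)
  obtain ⟨u0, u1, urest, rfl⟩ : ∃ u0 u1 urest, q = u0 :: u1 :: urest := by
    match q, hq2 with
    | u0 :: u1 :: urest, _ => exact ⟨u0, u1, urest, rfl⟩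
  set a := (p.getLast?.getD hvOrigin).1 with ha
  have hu0 : shift a 0 u0 = p.getLast hp := by simpa using hu0'
  have hcat_eq : hcat p (u0 :: u1 :: urest) = p ++ (shift a 0 u1 :: urest.map (shift a 0)) := by
    rw [hcat, ← ha]; rfl
  simp only [List.tail_cons, List.head_cons] at hqb
  have hxp : ∀ v ∈ p, xi v ≤ xi (p.getLast hp) := hpb
  have hxq : ∀ w ∈ shift a 0 u1 :: urest.map (shift a 0), xi (p.getLast hp) < xi w := by
    intro w hw
    have hw' : w ∈ (u1 :: urest).map (shift a 0) := by simpa using hw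
    rw [List.mem_map] at hw'
    obtain ⟨w0, hw0, rfl⟩ := hw'
    rw [← hu0, xi_shift_zero, xi_shift_zero]
    have := hqb w0 hw0
    linarith
  -- lengths, prefix, suffix
  have hne : hcat p (u0 :: u1 :: urest) ≠ [] := by rw [hcat_eq]; simp [hp]
  have hlen : (hcat p (u0 :: u1 :: urest)).length = p.length + (u0 :: u1 :: urest).length - 1 := by
    rw [hcat_eq, List.length_append]; simp only [List.length_cons, List.length_map]; omega
  have htake : (hcat p (u0 :: u1 :: urest)).take p.length = p := by rw [hcat_eq, List.take_left]
  have hdrop : (hcat p (u0 :: u1 :: urest)).drop (p.length - 1) = (u0 :: u1 :: urest).map (shift a 0) := by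
    rw [hcat_eq, List.drop_append_of_le_length (by omega), List.drop_length_sub_one hp, List.singleton_append]
    simp [hu0]
  -- columns by index
  have hxiAt_p : ∀ j, j < p.length → xiAt (hcat p (u0 :: u1 :: urest)) j = xiAt p j := by
    intro j hj
    rw [xiAt_eq_xi_getElem (by rw [hlen]; simp; omega), xiAt_eq_xi_getElem hj]
    simp only [hcat_eq, List.getElem_append_left hj]
  have hren : IsRenewalIdx (hcat p (u0 :: u1 :: urest)) (p.length - 1) := by
    refine ⟨by omega, by rw [hlen]; simp; omega, fun j hj => ?_, fun j hj hij => ?_⟩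
    · rw [mem_range] at hj
      rw [hxiAt_p j (by omega), hxiAt_p (p.length - 1) (by omega), xiAt_eq_xi_getElem (by omega),
        xiAt_eq_xi_getElem (by omega), ← List.getLast_eq_getElem hp]
      exact hxp _ (List.getElem_mem _)
    · rw [mem_range, hlen] at hj
      simp only [List.length_cons] at hj
      rw [hxiAt_p (p.length - 1) (by omega), xiAt_eq_xi_getElem (by omega), ← List.getLast_eq_getElem hp,
        xiAt_eq_xi_getElem (by rw [hlen]; simp; omega)]
      have hmem : (hcat p (u0 :: u1 :: urest))[j]'(by rw [hlen]; simp; omega) ∈ shift a 0 u1 :: urest.map (shift a 0) := by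
        simp only [hcat_eq]
        rw [List.getElem_append_right (by omega)]
        exact List.getElem_mem _
      exact hxq _ hmem
  have hheadc : (hcat p (u0 :: u1 :: urest)).head? = p.head? := by
    rw [hcat_eq, List.head?_append_of_ne_nil _ hp]
  have hlastc : ∀ hne' (hq' : (u0 :: u1 :: urest) ≠ []), (hcat p (u0 :: u1 :: urest)).getLast hne' =
      shift a 0 ((u0 :: u1 :: urest).getLast hq') := by
    intro hne' hq'
    simp only [hcat_eq]
    rw [List.getLast_append_of_ne_nil _ (List.cons_ne_nil _ _)]
    have : (shift a 0 u1 :: urest.map (shift a 0)) = ((u1 :: urest).map (shift a 0)) := rfl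
    simp only [this, List.getLast_map, List.getLast_cons_cons]
  refine ⟨hlen, htake, hdrop, hren, hheadc, hlastc, fun hpc hqc => ?_, fun hpn hqn => ?_, fun hpin hqin => ?_⟩
  · -- chain
    have hadj01 : hvGraph.Adj (p.getLast hp) (shift a 0 u1) := by
      rw [← hu0]
      exact (shift a 0).map_rel_iff.2 (List.isChain_cons_cons.1 hqc).1
    have hrestc : (shift a 0 u1 :: urest.map (shift a 0)).IsChain hvGraph.Adj := by
      have h2 : ((u1 :: urest).map (shift a 0)).IsChain hvGraph.Adj := by
        rw [List.isChain_map]; exact (List.isChain_cons_cons.1 hqc).2.imp fun x y h => (shift _ _).map_rel_iff.2 h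
      simpa using h2
    rw [hcat_eq]
    refine List.IsChain.append hpc hrestc fun x hx y hy => ?_
    rw [List.getLast?_eq_some_getLast hp, Option.mem_def, Option.some.injEq] at hx
    simp only [List.head?_cons, Option.mem_def, Option.some.injEq] at hy
    subst hx; subst hy
    exact hadj01
  · -- nodup
    rw [hcat_eq, List.nodup_append]
    have hqn' : ((u0 :: u1 :: urest).map (shift a 0)).Nodup := hqn.map (shift a 0).injective
    simp only [List.map_cons, List.nodup_cons] at hqn'
    refine ⟨hpn, List.nodup_cons.2 ⟨hqn'.2.1, hqn'.2.2⟩, fun v hv w hw hvw => ?_⟩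
    subst hvw
    have h1 := hxp v hv; have h2 := hxq v hw; linarith
  · -- levels
    intro v hv
    rw [hcat_eq, List.mem_append] at hv
    rcases hv with hv | hv
    · exact hpin v hv
    · have hv' : v ∈ (u1 :: urest).map (shift a 0) := by simpa using hv
      rw [List.mem_map] at hv'
      obtain ⟨w, hw, rfl⟩ := hv'
      rw [lev_shift_zero]; exact hqin w (by simp at hw ⊢; tauto)

/-- `IsRMax` passes to the glued list when the second list is `IsRMax` too. [cite: DuminilCopinHammond2013, §2.2; lane plumbing] -/
theorem isRMax_glue (hpR : IsRMax p) (hp2 : 2 ≤ p.length) (hqL : IsLMin q) (hqR : IsRMax q) (hq2 : 2 ≤ q.length)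
    (hq0 : ∀ hq : q ≠ [], (q.head hq).1 = 0) (hlev : ∀ (hp : p ≠ []) (hq : q ≠ []), lev (p.getLast hp) = lev (q.head hq)) :
    IsRMax (hcat p q) := by
  have hp : p ≠ [] := List.ne_nil_of_length_pos (by omega)
  have hq : q ≠ [] := List.ne_nil_of_length_pos (by omega)
  obtain ⟨hlen, htake, hdrop, hren, -, hlast, -⟩ := glue_spec (T := 0) hpR hp2 hqL hq2 hq0 hlev
  have hne : hcat p q ≠ [] := List.ne_nil_of_length_pos (by rw [hlen]; omega)
  rw [isRMax_iff_xiAt]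
  refine ⟨hne, fun j hj => ?_⟩
  obtain ⟨-, -, hle, hlt⟩ := hren
  -- the last column of the glued list is the (shifted) last column of `q`, which dominates the columns of `q`
  have hlastcol : ∀ k, p.length - 1 ≤ k → k < (hcat p q).length → xiAt (hcat p q) k ≤ xiAt (hcat p q) ((hcat p q).length - 1) := by
    intro k hk hkl
    obtain ⟨hqne, hqb⟩ := hqR
    have e1 : xiAt (hcat p q) k = xiAt ((hcat p q).drop (p.length - 1)) (k - (p.length - 1)) := by
      rw [xiAt_drop]; congr 1; omega
    have e2 : xiAt (hcat p q) ((hcat p q).length - 1) = xiAt ((hcat p q).drop (p.length - 1)) (q.length - 1) := by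
      rw [xiAt_drop]; congr 1; omega
    have hidx : k - (p.length - 1) < q.length := by rw [hlen] at hkl; omega
    rw [e1, e2, hdrop, xiAt_map_shift _ _ hidx, xiAt_map_shift _ _ (by omega), xiAt_eq_xi_getElem hidx,
      xiAt_eq_xi_getElem (by omega), ← List.getLast_eq_getElem hqne]
    have := hqb (q[k - (p.length - 1)]'hidx) (List.getElem_mem hidx)
    linarith
  by_cases hjp : j < p.length - 1
  · exact (hle j (mem_range.2 (by omega))).trans (hlastcol (p.length - 1) le_rfl (by rw [hlen]; omega))
  · exact hlastcol j (by omega) hj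

end Glue


/-- `IsRMax` is translation invariant. [cite: DuminilCopinHammond2013, §2.2; lane plumbing] -/
theorem isRMax_map_shift {l : List HV} (a : ℤ) (h : IsRMax l) : IsRMax (l.map (shift a 0)) := by
  obtain ⟨hne, hb⟩ := h
  refine ⟨by simpa using hne, fun v hv => ?_⟩
  rw [List.mem_map] at hv
  obtain ⟨w, hw, rfl⟩ := hv
  rw [List.getLast_map, xi_shift_zero, xi_shift_zero]
  linarith [hb w hw]

/-- `IsLMin` is translation invariant. [cite: DuminilCopinHammond2013, §2.2; lane plumbing] -/
theorem isLMin_map_shift {l : List HV} (a : ℤ) (h : IsLMin l) : IsLMin (l.map (shift a 0)) := by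
  obtain ⟨hne, hb⟩ := h
  refine ⟨by simpa using hne, fun v hv => ?_⟩
  rw [← List.map_tail, List.mem_map] at hv
  obtain ⟨w, hw, rfl⟩ := hv
  rw [List.head_map, xi_shift_zero, xi_shift_zero]
  linarith [hb w hw]

/-- `IsRMax` passes to nonempty suffixes. [cite: DuminilCopinHammond2013, §2.2; lane plumbing] -/
theorem isRMax_drop {l : List HV} (h : IsRMax l) {n : ℕ} (hn : n < l.length) : IsRMax (l.drop n) := by
  obtain ⟨hne, hb⟩ := h
  have hne' : l.drop n ≠ [] := by rw [ne_eq, List.drop_eq_nil_iff]; omega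
  refine ⟨hne', fun v hv => ?_⟩
  rw [List.getLast_drop]
  exact hb v (List.drop_subset _ _ hv)

/-- `IsLMin` passes to nonempty prefixes. [cite: DuminilCopinHammond2013, §2.2; lane plumbing] -/
theorem isLMin_take {l : List HV} (h : IsLMin l) {n : ℕ} (hn : 1 ≤ n) : IsLMin (l.take n) := by
  obtain ⟨hne, hb⟩ := h
  have hne' : l.take n ≠ [] := by rw [ne_eq, List.take_eq_nil_iff]; simp [hne]; omega
  refine ⟨hne', fun v hv => ?_⟩
  rw [List.head_take]
  rw [← List.drop_one, List.drop_take] at hv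
  exact hb v (by rw [← List.drop_one]; exact List.take_subset _ _ hv)

/-! ### §3 The last renewal index and the three-piece renewal split of a list -/

section ThreePieces

variable {T : ℕ} {l : List HV}

/-- The LAST renewal index (junk `0` if there is none). [cite: DuminilCopinHammond2013, §2.2 (renewal points R_γ)] -/
def lIdx (l : List HV) : ℕ := if h : (renIdxs l).Nonempty then (renIdxs l).max' h else 0

/-- The standardised MIDDLE piece `xstd l[f .. ℓ]` between the first and the last renewal index (a single vertex when `f = ℓ`).
[cite: DuminilCopinHammond2013, §2.2 (decomposition at renewal points)] -/
def midPc (l : List HV) : List HV := xstd ((l.take (lIdx l + 1)).drop (fIdx l))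

/-- The standardised TAIL piece `xstd l[ℓ ..]` after the last renewal index. [cite: DuminilCopinHammond2013, §2.2 (decomposition at renewal points)] -/
def tailPc (l : List HV) : List HV := xstd (l.drop (lIdx l))

/-- The last renewal index is a renewal index and the largest one. [cite: DuminilCopinHammond2013, §2.2] -/
theorem lIdx_spec (h : (renIdxs l).Nonempty) : IsRenewalIdx l (lIdx l) ∧ ∀ j, IsRenewalIdx l j → j ≤ lIdx l := by
  have hf : lIdx l = (renIdxs l).max' h := by rw [lIdx, dif_pos h]
  have hmem := (renIdxs l).max'_mem h
  rw [← hf, renIdxs, mem_filter] at hmem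
  refine ⟨hmem.2, fun j hj => ?_⟩
  rw [hf]
  exact (renIdxs l).le_max' j (mem_filter.2 ⟨mem_range.2 (by have := hj.2.1; omega), hj⟩)

/-- `fIdx ≤ lIdx`. [cite: DuminilCopinHammond2013, §2.2; lane plumbing] -/
theorem fIdx_le_lIdx (h : (renIdxs l).Nonempty) : fIdx l ≤ lIdx l := (lIdx_spec h).2 _ (fIdx_spec h).1

/-- Index bookkeeping of the three pieces: `0 < f ≤ ℓ`, `ℓ + 1 < |l|`, and the lengths `|fstP| = f + 1`, `|midPc| = ℓ + 1 − f`,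
`|tailPc| = |l| − ℓ`. [cite: DuminilCopinHammond2013, §2.2; lane plumbing] -/
theorem threePieces_lengths (h : (renIdxs l).Nonempty) :
    0 < fIdx l ∧ fIdx l ≤ lIdx l ∧ lIdx l + 1 < l.length ∧ (fstP l).length = fIdx l + 1 ∧
      (midPc l).length = lIdx l + 1 - fIdx l ∧ (tailPc l).length = l.length - lIdx l := by
  obtain ⟨⟨hf0, hf1, -, -⟩, -⟩ := fIdx_spec h
  obtain ⟨⟨-, hl1, -, -⟩, -⟩ := lIdx_spec h
  have hfl := fIdx_le_lIdx h
  refine ⟨hf0, hfl, hl1, (length_fstP_sndP h).1, ?_, ?_⟩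
  · rw [midPc, length_xstd, List.length_drop, List.length_take]; omega
  · rw [tailPc, length_xstd, List.length_drop]

/-- ★ **The three pieces re-assemble the list**: `l = fstP l ++ (l[f..ℓ]).tail ++ (l[ℓ..]).tail`.
[cite: DuminilCopinHammond2013, §2.2 (a bridge is the concatenation of its pieces)] -/
theorem fstP_append_mid_append_tail (h : (renIdxs l).Nonempty) :
    fstP l ++ ((l.take (lIdx l + 1)).drop (fIdx l)).tail ++ (l.drop (lIdx l)).tail = l := by
  have hfl := fIdx_le_lIdx h
  have h1 : fstP l ++ ((l.take (lIdx l + 1)).drop (fIdx l)).tail = l.take (lIdx l + 1) := by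
    rw [fstP, List.tail_drop]
    have : l.take (fIdx l + 1) = (l.take (lIdx l + 1)).take (fIdx l + 1) := by
      rw [List.take_take, Nat.min_eq_left (by omega)]
    rw [this, List.take_append_drop]
  rw [h1, List.tail_drop, List.take_append_drop]

/-- Weights and contacts are additive over the three pieces: `|l| + 2 = |fstP| + |midPc| + |tailPc|` and
`#top(l) = #top(fstP) + #top((midPc).tail) + #top((tailPc).tail)`. [cite: BeatonBousquetMelouDeGierDuminilCopinGuttmann2014, §3.2 (weights x^{|γ|} y^{#contacts}); lane plumbing] -/
theorem threePieces_weights (h : (renIdxs l).Nonempty) (T : ℕ) :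
    l.length + 2 = (fstP l).length + (midPc l).length + (tailPc l).length ∧
      topCnt T l = topCnt T (fstP l) + topCnt T (midPc l).tail + topCnt T (tailPc l).tail := by
  obtain ⟨hf0, hfl, hl1, hlen1, hlen2, hlen3⟩ := threePieces_lengths h
  have hdec := fstP_append_mid_append_tail h
  constructor
  · omega
  · conv_lhs => rw [← hdec]
    rw [topCnt_append, topCnt_append, midPc, tailPc, topCnt_tail_xstd, topCnt_tail_xstd]

/-- The pieces' end vertices: last of `fstP` = `l[f]` = head of the middle segment, last of the middle segment = `l[ℓ]` = head of
`l[ℓ..]`, last of `l[ℓ..]` = last of `l`. [cite: DuminilCopinHammond2013, §2.2; lane plumbing] -/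
theorem threePieces_ends (h : (renIdxs l).Nonempty) :
    (fstP l).getLast? = some (l[fIdx l]'(by have := (threePieces_lengths h).2.2.1; have := (threePieces_lengths h).2.1; omega)) ∧
    ((l.take (lIdx l + 1)).drop (fIdx l)).head? = some (l[fIdx l]'(by have := (threePieces_lengths h).2.2.1; have := (threePieces_lengths h).2.1; omega)) ∧
    ((l.take (lIdx l + 1)).drop (fIdx l)).getLast? = some (l[lIdx l]'(by have := (threePieces_lengths h).2.2.1; omega)) ∧
    (l.drop (lIdx l)).head? = some (l[lIdx l]'(by have := (threePieces_lengths h).2.2.1; omega)) ∧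
    (l.drop (lIdx l)).getLast? = l.getLast? := by
  obtain ⟨hf0, hfl, hl1, hlen1, -, -⟩ := threePieces_lengths h
  have hne1 : fstP l ≠ [] := (fstP_sndP_ne_nil h).1
  have hneM : (l.take (lIdx l + 1)).drop (fIdx l) ≠ [] := by
    rw [ne_eq, List.drop_eq_nil_iff, List.length_take]; omega
  have hneT : l.drop (lIdx l) ≠ [] := by rw [ne_eq, List.drop_eq_nil_iff]; omega
  have hl : l ≠ [] := List.ne_nil_of_length_pos (by omega)
  refine ⟨?_, ?_, ?_, ?_, ?_⟩
  · rw [List.getLast?_eq_some_getLast hne1, (fstP_sndP_ends h).2.1 hne1]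
  · rw [List.head?_drop, List.getElem?_take_of_lt (by omega), List.getElem?_eq_getElem (by omega)]
  · rw [List.getLast?_eq_some_getLast hneM, List.getLast_drop, getLast_take_succ (by omega)]
  · rw [List.head?_drop, List.getElem?_eq_getElem (by omega)]
  · rw [List.getLast?_eq_some_getLast hneT, List.getLast_drop, List.getLast?_eq_some_getLast hl]

/-- ★ **The split is a left inverse of gluing**: `hcat (hcat (fstP l) (midPc l)) (tailPc l) = l` for every list with a renewal
index — in particular `l ↦ (fstP l, midPc l, tailPc l)` is injective there. [cite: DuminilCopinHammond2013, §2.2 (unique decomposition)] -/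
theorem glue_threePieces (h : (renIdxs l).Nonempty) : hcat (hcat (fstP l) (midPc l)) (tailPc l) = l := by
  obtain ⟨hf0, hfl, hl1, hlen1, -, -⟩ := threePieces_lengths h
  obtain ⟨e1, e2, e3, e4, -⟩ := threePieces_ends h
  -- the translates of the standardised pieces are the original segments
  have hmM : (midPc l).map (shift (l[fIdx l]'(by omega)).1 0) = (l.take (lIdx l + 1)).drop (fIdx l) := by
    have hm := map_shift_xstd ((l.take (lIdx l + 1)).drop (fIdx l))
    rwa [List.headD_eq_head?_getD, e2, Option.getD_some] at hm
  have hmR : (tailPc l).map (shift (l[lIdx l]'(by omega)).1 0) = l.drop (lIdx l) := by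
    have hm := map_shift_xstd (l.drop (lIdx l))
    rwa [List.headD_eq_head?_getD, e4, Option.getD_some] at hm
  -- inner gluing
  have hin : hcat (fstP l) (midPc l) = l.take (lIdx l + 1) := by
    rw [hcat, e1, Option.getD_some, List.map_tail, hmM, fstP, List.tail_drop]
    have : l.take (fIdx l + 1) = (l.take (lIdx l + 1)).take (fIdx l + 1) := by
      rw [List.take_take, Nat.min_eq_left (by omega)]
    rw [this, List.take_append_drop]
  have hlastP : (l.take (lIdx l + 1)).getLast? = some (l[lIdx l]'(by omega)) := by
    have hneP : l.take (lIdx l + 1) ≠ [] := by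
      rw [ne_eq, List.take_eq_nil_iff, not_or]
      exact ⟨by omega, List.ne_nil_of_length_pos (by omega)⟩
    rw [List.getLast?_eq_some_getLast hneP, getLast_take_succ (by omega)]
  rw [hin, hcat, hlastP, Option.getD_some, List.map_tail, hmR, List.tail_drop, List.take_append_drop]

/-- ★ **Injectivity of the three-piece split** on lists with a renewal index. [cite: DuminilCopinHammond2013, §2.2 (unique decomposition)] -/
theorem threePieces_injOn : Set.InjOn (fun l : List HV => (fstP l, midPc l, tailPc l)) {l | (renIdxs l).Nonempty} := by
  intro l hl l' hl' heq
  simp only [Prod.mk.injEq] at heq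
  obtain ⟨h1, h2, h3⟩ := heq
  rw [← glue_threePieces hl, ← glue_threePieces hl', h1, h2, h3]

/-- ★ **Properties of the three pieces**: the head piece is `IsRMax` without renewal index, the tail piece is `IsLMin` without
renewal index, and the middle piece is a standard horizontal bridge when `f < ℓ` (a single standard vertex when `f = ℓ`).
[cite: DuminilCopinHammond2013, §2.2 ("γ[0,i] and γ[i,n] are bridges"; the irreducible pieces)] -/
theorem threePieces_props (h : (renIdxs l).Nonempty) :
    IsRMax (fstP l) ∧ renIdxs (fstP l) = ∅ ∧ IsLMin (tailPc l) ∧ renIdxs (tailPc l) = ∅ ∧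
      IsHBridge (midPc l) ∧ (∀ hne, ((midPc l).head hne).1 = 0) ∧ (∀ hne, ((tailPc l).head hne).1 = 0) := by
  obtain ⟨hf0, hfl, hl1, hlen1, hlen2, hlen3⟩ := threePieces_lengths h
  have hF := (fIdx_spec h).1
  have hL := (lIdx_spec h).1
  obtain ⟨-, hRf, -⟩ := split_take_spec hF
  obtain ⟨-, hLf, -⟩ := split_drop_spec hF
  obtain ⟨-, hRl, -⟩ := split_take_spec hL
  obtain ⟨-, hLl, hrenl⟩ := split_drop_spec hL
  refine ⟨hRf, renIdxs_fstP h, ?_, ?_, ?_, fun hne => ?_, fun hne => ?_⟩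
  · rw [tailPc, xstd]; exact isLMin_map_shift _ hLl
  · rw [tailPc, xstd, renIdxs_map_shift, Finset.eq_empty_iff_forall_notMem]
    intro j hj
    rw [renIdxs, mem_filter] at hj
    have := (hrenl j).1 hj.2
    have := (lIdx_spec h).2 _ this.2
    omega
  · rcases Nat.lt_or_ge (fIdx l) (lIdx l) with hlt | hge
    · rw [midPc]
      refine isHBridge_xstd (isHBridge_iff_isLMin_and_isRMax.2 ⟨?_, ?_⟩)
      · rw [List.drop_take]
        exact isLMin_take hLf (by omega)
      · exact isRMax_drop hRl (by rw [List.length_take]; omega)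
    · -- `f = ℓ`: a single vertex, vacuously a bridge
      obtain ⟨v, hv⟩ := List.length_eq_one_iff.1 (show (midPc l).length = 1 by rw [hlen2]; omega)
      rw [hv]; exact ⟨List.cons_ne_nil _ _, fun w hw => by simp at hw⟩
  · have hm : (l.take (lIdx l + 1)).drop (fIdx l) ≠ [] := by rw [ne_eq, List.drop_eq_nil_iff, List.length_take]; omega
    have e := head?_xstd (List.head?_eq_some_head hm)
    have e' := (List.head?_eq_some_head hne).symm.trans e
    rw [Option.some_inj.1 e']
  · have hm : l.drop (lIdx l) ≠ [] := by rw [ne_eq, List.drop_eq_nil_iff]; omega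
    have e := head?_xstd (List.head?_eq_some_head hm)
    have e' := (List.head?_eq_some_head hne).symm.trans e
    rw [Option.some_inj.1 e']

/-- Levels are translation invariant: `hdLev`/`ltLev` of a horizontal translate. [cite: DuminilCopinSmirnov2012, §3 (levels of the strip); lane plumbing] -/
theorem hdLev_ltLev_map_shift (a : ℤ) (m : List HV) : hdLev (m.map (shift a 0)) = hdLev m ∧ ltLev (m.map (shift a 0)) = ltLev m := by
  constructor
  · rw [hdLev, hdLev, List.head?_map]
    cases m.head? with
    | none => rfl
    | some v => simp only [Option.map_some, Option.getD_some, lev_shift_zero]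
  · rw [ltLev, ltLev, List.getLast?_map]
    cases m.getLast? with
    | none => rfl
    | some v => simp only [Option.map_some, Option.getD_some, lev_shift_zero]

/-- Levels of the pieces' ends: `ltLev (fstP l) = hdLev (midPc l) = lev l[f]`, `ltLev (midPc l) = hdLev (tailPc l) = lev l[ℓ]`,
`ltLev (tailPc l) = ltLev l`. [cite: DuminilCopinSmirnov2012, §3 (levels of the strip); lane plumbing] -/
theorem threePieces_levels (h : (renIdxs l).Nonempty) :
    ltLev (fstP l) = hdLev (midPc l) ∧ ltLev (midPc l) = hdLev (tailPc l) ∧ ltLev (tailPc l) = ltLev l := by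
  obtain ⟨e1, e2, e3, e4, e5⟩ := threePieces_ends h
  have hx : ∀ m : List HV, hdLev (xstd m) = hdLev m ∧ ltLev (xstd m) = ltLev m := fun m => hdLev_ltLev_map_shift _ m
  refine ⟨?_, ?_, ?_⟩
  · rw [midPc, (hx _).1, ltLev, hdLev, e1, e2]
  · rw [midPc, tailPc, (hx _).2, (hx _).1, ltLev, hdLev, e3, e4]
  · rw [tailPc, (hx _).2, ltLev, ltLev, e5]

end ThreePieces


/-! ### §4 The classes of heads, middle bridges and tails, and the memberships of the three pieces -/

section Classes

variable {T : ℕ}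

/-- The β-walks of `S_{T,L}` WITH a renewal index (they are all of case A: `renA_subset_caseA`).
[cite: DuminilCopinHammond2013, §2.2 (renewal points); DuminilCopinSmirnov2012, §3 (walks a → β of S_{T,L})] -/
def renA (T L : ℕ) : Finset (List HV) := (bridgeLists T L).filter fun l => (renIdxs l).Nonempty

/-- **Heads**: self-avoiding lists of `S_T` from the origin with `2 ≤ |h| ≤ N + 1` vertices, all columns `≤` the last column, NO
renewal index, last vertex on level `c`.  (The first pieces of the renewal split of β-walks.) [cite: DuminilCopinHammond2013, §2.2; lane «pcv-sawmu» a-p2 g20] -/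
def headN (T N : ℕ) (c : ℤ) : Finset (List HV) :=
  ((Finset.range (N + 1)).biUnion fun n => stripChains T n).filter
    fun h => h.head? = some hvOrigin ∧ 2 ≤ h.length ∧ IsRMax h ∧ renIdxs h = ∅ ∧ ltLev h = c

/-- **Tails**: standard-head self-avoiding lists of `S_T` with `2 ≤ |g| ≤ N + 1` vertices, all later columns `>` the head column, NO
renewal index, from level `e` to the top level `2T − 1`.  (The last pieces of the renewal split of β-walks.) [cite: DuminilCopinHammond2013, §2.2; lane «pcv-sawmu» a-p2 g20] -/
def tailN (T N : ℕ) (e : ℤ) : Finset (List HV) :=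
  ((Finset.range (N + 1)).biUnion fun n => stripChains T n).filter
    fun g => 2 ≤ g.length ∧ IsLMin g ∧ renIdxs g = ∅ ∧ hdLev g = e ∧ ltLev g = 2 * (T : ℤ) - 1

/-- **Middle pieces**: ALL standard horizontal bridges of `S_T` from level `c` to level `e` with at most `N + 1` vertices, the trivial
one-vertex bridge included (`= HBab T N c e ∪ {[v_c]}` when `c = e`). [cite: DuminilCopinHammond2013, §2.2 (bridges); lane plumbing] -/
def HB0 (T N : ℕ) (c e : ℤ) : Finset (List HV) := (hBridgesN T N).filter fun b => hdLev b = c ∧ ltLev b = e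

/-- Membership in the union of the `stripChains` up to `N` steps. [cite: MadrasSlade1993, §8.2 eq. (8.2.1); lane plumbing] -/
theorem mem_biUnion_stripChains_iff {N : ℕ} {l : List HV} :
    l ∈ (Finset.range (N + 1)).biUnion (fun n => stripChains T n) ↔
      l.IsChain hvGraph.Adj ∧ l.Nodup ∧ l ≠ [] ∧ l.length ≤ N + 1 ∧ (∃ v, l.head? = some v ∧ v.1 = 0) ∧ InLev T l := by
  rw [mem_biUnion]
  constructor
  · rintro ⟨n, hn, hsc⟩
    obtain ⟨hc, hnd, hlen, hh, hin⟩ := mem_stripChains_iff.1 hsc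
    rw [mem_range] at hn
    exact ⟨hc, hnd, List.ne_nil_of_length_pos (by omega), by omega, hh, hin⟩
  · rintro ⟨hc, hnd, hne, hlen, hh, hin⟩
    have := List.length_pos_of_ne_nil hne
    exact ⟨l.length - 1, mem_range.2 (by omega), mem_stripChains_iff.2 ⟨hc, hnd, by omega, hh, hin⟩⟩

/-- A β-walk with a renewal index is of case A. [cite: DuminilCopinHammond2013, §2.2; lane plumbing] -/
theorem renA_subset_caseA (L : ℕ) : renA T L ⊆ caseA T L := by
  intro l hl
  rw [renA, mem_filter] at hl
  obtain ⟨i, hi⟩ := hl.2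
  rw [renIdxs, mem_filter] at hi
  rw [caseA, mem_filter]
  exact ⟨hl.1, sIdx_lt_tIdx_of_isRenewalIdx hi.2⟩

/-- `renA` is `caseA` restricted to the walks with a renewal index; `noRenA ⊔ renA = caseA`. [cite: DuminilCopinHammond2013, §2.2; lane plumbing] -/
theorem renA_eq_filter_caseA (L : ℕ) : renA T L = (caseA T L).filter fun l => (renIdxs l).Nonempty := by
  ext l
  rw [mem_filter, renA, mem_filter, caseA, mem_filter]
  constructor
  · rintro ⟨hl, hne⟩
    obtain ⟨i, hi⟩ := hne
    have hi' := hi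
    rw [renIdxs, mem_filter] at hi'
    exact ⟨⟨hl, sIdx_lt_tIdx_of_isRenewalIdx hi'.2⟩, ⟨i, hi⟩⟩
  · rintro ⟨⟨hl, -⟩, hne⟩
    exact ⟨hl, hne⟩

variable {L N : ℕ} {l : List HV}

/-- Data of a member of `renA`. [cite: DuminilCopinSmirnov2012, §3; lane plumbing] -/
theorem of_mem_renA (hT : 1 ≤ T) (hl : l ∈ renA T L) :
    l.IsChain hvGraph.Adj ∧ l.head? = some hvOrigin ∧ l.Nodup ∧ (∀ v ∈ l, v ∈ stripV T L) ∧ InLev T l ∧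
      (∃ h : l ≠ [], lev (l.getLast h) = 2 * (T : ℤ) - 1) ∧ (renIdxs l).Nonempty ∧ ltLev l = 2 * (T : ℤ) - 1 := by
  rw [renA, mem_filter] at hl
  obtain ⟨hc, hh, hnd, hV, hne, hlast⟩ := (mem_bridgeLists_iff hT).1 hl.1
  refine ⟨hc, hh, hnd, hV, inLev_of_subset hV (fun _ h => h), ⟨hne, hlast⟩, hl.2, ?_⟩
  rw [ltLev, List.getLast?_eq_some_getLast hne, Option.getD_some, hlast]

/-- ★ The head piece of a β-walk with a renewal index is a head (class `headN`). [cite: DuminilCopinHammond2013, §2.2; lane «pcv-sawmu» a-p2 g20] -/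
theorem fstP_mem_headN (hT : 1 ≤ T) (hl : l ∈ renA T L) (hN : l.length ≤ N + 1) : fstP l ∈ headN T N (ltLev (fstP l)) := by
  obtain ⟨hc, hh, hnd, hV, hin, -, hne, -⟩ := of_mem_renA hT hl
  obtain ⟨hf0, hfl, hl1, hlen1, -, -⟩ := threePieces_lengths hne
  obtain ⟨hR, hren, -⟩ := threePieces_props hne
  have hsub : (fstP l).Sublist l := List.take_sublist _ _
  have hhead : (fstP l).head? = some hvOrigin := by rw [fstP, List.head?_take, if_neg (by omega), hh]
  rw [headN, mem_filter, mem_biUnion_stripChains_iff]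
  exact ⟨⟨hc.take _, hnd.sublist hsub, (fstP_sndP_ne_nil hne).1, by omega, ⟨hvOrigin, hhead, rfl⟩,
    fun v hv => hin v (hsub.subset hv)⟩, hhead, by omega, hR, hren, rfl⟩

/-- ★ The tail piece of a β-walk with a renewal index is a tail (class `tailN`). [cite: DuminilCopinHammond2013, §2.2; lane «pcv-sawmu» a-p2 g20] -/
theorem tailPc_mem_tailN (hT : 1 ≤ T) (hl : l ∈ renA T L) (hN : l.length ≤ N + 1) : tailPc l ∈ tailN T N (hdLev (tailPc l)) := by
  obtain ⟨hc, hh, hnd, hV, hin, -, hne, hlast⟩ := of_mem_renA hT hl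
  obtain ⟨hf0, hfl, hl1, -, -, hlen3⟩ := threePieces_lengths hne
  obtain ⟨-, -, hL, hren, -, -, hstd⟩ := threePieces_props hne
  obtain ⟨-, -, hlt⟩ := threePieces_levels hne
  have hsub : (l.drop (lIdx l)).Sublist l := List.drop_sublist _ _
  have hneT : tailPc l ≠ [] := List.ne_nil_of_length_pos (by rw [hlen3]; omega)
  rw [tailN, mem_filter, mem_biUnion_stripChains_iff]
  refine ⟨⟨?_, ?_, hneT, by rw [hlen3]; omega, ⟨(tailPc l).head hneT, List.head?_eq_some_head hneT, hstd hneT⟩, ?_⟩,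
    by rw [hlen3]; omega, hL, hren, rfl, by rw [hlt, hlast]⟩
  · rw [tailPc]; exact isChain_xstd (hc.drop _)
  · rw [tailPc]; exact nodup_xstd (hnd.sublist hsub)
  · rw [tailPc]; exact inLev_xstd fun v hv => hin v (hsub.subset hv)

/-- ★ The middle piece of a β-walk with a renewal index is a (possibly trivial) standard horizontal bridge (class `HB0`).
[cite: DuminilCopinHammond2013, §2.2; lane «pcv-sawmu» a-p2 g20] -/
theorem midPc_mem_HB0 (hT : 1 ≤ T) (hl : l ∈ renA T L) (hN : l.length ≤ N + 1) :
    midPc l ∈ HB0 T N (hdLev (midPc l)) (ltLev (midPc l)) := by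
  obtain ⟨hc, hh, hnd, hV, hin, -, hne, -⟩ := of_mem_renA hT hl
  obtain ⟨hf0, hfl, hl1, -, hlen2, -⟩ := threePieces_lengths hne
  obtain ⟨-, -, -, -, hB, hstd, -⟩ := threePieces_props hne
  have hsub : ((l.take (lIdx l + 1)).drop (fIdx l)).Sublist l := (List.drop_sublist _ _).trans (List.take_sublist _ _)
  have hneM : midPc l ≠ [] := List.ne_nil_of_length_pos (by rw [hlen2]; omega)
  rw [HB0, mem_filter, mem_hBridgesN_iff]
  refine ⟨⟨?_, ?_, by rw [hlen2]; omega, ⟨(midPc l).head hneM, List.head?_eq_some_head hneM, hstd hneM⟩, ?_, hB⟩, rfl, rfl⟩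
  · rw [midPc]; exact isChain_xstd ((hc.take _).drop _)
  · rw [midPc]; exact nodup_xstd (hnd.sublist hsub)
  · rw [midPc]; exact inLev_xstd fun v hv => hin v (hsub.subset hv)

/-- The weight and the contacts of a β-walk split over its three pieces: `|ω| = |h| + (|b| − 1) + (|g| − 1)` and
`#top(ω) = #top(h) + #top(b.tail) + #top(g.tail)`. [cite: BeatonBousquetMelouDeGierDuminilCopinGuttmann2014, §3.2 (weights x_c^{|γ|} y^{#contacts}); lane plumbing] -/
theorem length_topCnt_threePieces (hne : (renIdxs l).Nonempty) (T : ℕ) :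
    l.length = (fstP l).length + ((midPc l).length - 1) + ((tailPc l).length - 1) ∧
      topCnt T l = topCnt T (fstP l) + topCnt T (midPc l).tail + topCnt T (tailPc l).tail := by
  obtain ⟨hf0, hfl, hl1, hlen1, hlen2, hlen3⟩ := threePieces_lengths hne
  obtain ⟨h1, h2⟩ := threePieces_weights hne T
  exact ⟨by omega, h2⟩

end Classes


/-! ### §5 Gluing a head, a middle bridge and a tail: the split recovers the pieces -/

section Glue3

variable {T : ℕ}

/-- The glued walk `h ⊕ b ⊕ g`. [cite: DuminilCopinHammond2013, §2.2 (concatenation of bridges)] -/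
def glue3 (h b g : List HV) : List HV := hcat (hcat h b) g

/-- ★ **Renewal indices of a glued list**: under the hypotheses of `glue_spec`, `j` is a renewal index of `hcat p q` iff it is a
renewal index of `p` below `|p| − 1`, or `j = |p| − 1`, or it is (after the shift by `|p| − 1`) a renewal index of `q`.
[cite: DuminilCopinHammond2013, §2.2 (renewal points of a concatenation); lane «pcv-sawmu» a-p2 g20] -/
theorem isRenewalIdx_hcat_iff {p q : List HV} (hpR : IsRMax p) (hp2 : 2 ≤ p.length) (hqL : IsLMin q) (hq2 : 2 ≤ q.length)
    (hq0 : ∀ hq : q ≠ [], (q.head hq).1 = 0) (hlev : ∀ (hp : p ≠ []) (hq : q ≠ []), lev (p.getLast hp) = lev (q.head hq)) (j : ℕ) :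
    IsRenewalIdx (hcat p q) j ↔ (j < p.length - 1 ∧ IsRenewalIdx p j) ∨ j = p.length - 1 ∨
      (p.length - 1 < j ∧ IsRenewalIdx q (j - (p.length - 1))) := by
  obtain ⟨hlen, htake, hdrop, hren, -⟩ := glue_spec (T := 0) hpR hp2 hqL hq2 hq0 hlev
  obtain ⟨-, -, hlow⟩ := split_take_spec hren
  obtain ⟨-, -, hupp⟩ := split_drop_spec hren
  rw [show p.length - 1 + 1 = p.length by omega, htake] at hlow
  rw [hdrop] at hupp
  rcases Nat.lt_trichotomy j (p.length - 1) with hj | hj | hj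
  · rw [hlow j hj]
    constructor
    · intro h; exact Or.inl ⟨hj, h⟩
    · rintro (⟨-, h⟩ | h | ⟨h, -⟩)
      · exact h
      · omega
      · omega
  · subst hj
    exact ⟨fun _ => Or.inr (Or.inl rfl), fun _ => hren⟩
  · have e : j = p.length - 1 + (j - (p.length - 1)) := by omega
    constructor
    · intro h
      rw [e] at h
      have h' := ((hupp _).2 ⟨by omega, h⟩)
      rw [isRenewalIdx_map_shift] at h'
      exact Or.inr (Or.inr ⟨hj, h'⟩)
    · rintro (⟨h, -⟩ | h | ⟨-, h⟩)
      · omega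
      · omega
      · have h' := (hupp (j - (p.length - 1))).1 (by rw [isRenewalIdx_map_shift]; exact h)
        rw [← e] at h'
        exact h'.2

/-- `ltLev (hcat p q) = ltLev q` and `(hcat p q).head? = p.head?` under the gluing hypotheses. [cite: DuminilCopinHammond2013, §2.2; lane plumbing] -/
theorem hdLev_ltLev_hcat {p q : List HV} (hpR : IsRMax p) (hp2 : 2 ≤ p.length) (hqL : IsLMin q) (hq2 : 2 ≤ q.length)
    (hq0 : ∀ hq : q ≠ [], (q.head hq).1 = 0) (hlev : ∀ (hp : p ≠ []) (hq : q ≠ []), lev (p.getLast hp) = lev (q.head hq)) :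
    (hcat p q).head? = p.head? ∧ ltLev (hcat p q) = ltLev q := by
  obtain ⟨hlen, -, -, -, hhead, hlast, -⟩ := glue_spec (T := 0) hpR hp2 hqL hq2 hq0 hlev
  have hne : hcat p q ≠ [] := List.ne_nil_of_length_pos (by rw [hlen]; omega)
  have hq : q ≠ [] := List.ne_nil_of_length_pos (by omega)
  refine ⟨hhead, ?_⟩
  rw [ltLev, ltLev, List.getLast?_eq_some_getLast hne, List.getLast?_eq_some_getLast hq, Option.getD_some, Option.getD_some,
    hlast hne hq, lev_shift_zero]

variable {N N' L : ℕ} {c e : ℤ} {h b g : List HV}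

/-- Data of a head. [cite: DuminilCopinHammond2013, §2.2; lane plumbing] -/
theorem of_mem_headN (hh : h ∈ headN T N c) :
    h.IsChain hvGraph.Adj ∧ h.Nodup ∧ h.length ≤ N + 1 ∧ h.head? = some hvOrigin ∧ InLev T h ∧ 2 ≤ h.length ∧ IsRMax h ∧
      renIdxs h = ∅ ∧ ltLev h = c ∧ (∀ hne : h ≠ [], (h.head hne).1 = 0) := by
  rw [headN, mem_filter, mem_biUnion_stripChains_iff] at hh
  obtain ⟨⟨hc, hnd, -, hlen, -, hin⟩, hhd, h2, hR, hren, hlt⟩ := hh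
  refine ⟨hc, hnd, hlen, hhd, hin, h2, hR, hren, hlt, fun hne => ?_⟩
  rw [List.head?_eq_some_head hne, Option.some_inj] at hhd
  rw [hhd]; rfl

/-- Data of a tail. [cite: DuminilCopinHammond2013, §2.2; lane plumbing] -/
theorem of_mem_tailN (hg : g ∈ tailN T N e) :
    g.IsChain hvGraph.Adj ∧ g.Nodup ∧ g.length ≤ N + 1 ∧ (∀ hne : g ≠ [], (g.head hne).1 = 0) ∧ InLev T g ∧ 2 ≤ g.length ∧ IsLMin g ∧
      renIdxs g = ∅ ∧ hdLev g = e ∧ ltLev g = 2 * (T : ℤ) - 1 := by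
  rw [tailN, mem_filter, mem_biUnion_stripChains_iff] at hg
  obtain ⟨⟨hc, hnd, -, hlen, ⟨v, hv, hv0⟩, hin⟩, h2, hL, hren, hhd, hlt⟩ := hg
  refine ⟨hc, hnd, hlen, fun hne => ?_, hin, h2, hL, hren, hhd, hlt⟩
  rw [List.head?_eq_some_head hne, Option.some_inj] at hv
  rw [hv]; exact hv0

/-- Data of a middle piece. [cite: DuminilCopinHammond2013, §2.2; lane plumbing] -/
theorem of_mem_HB0 (hb : b ∈ HB0 T N c e) :
    b.IsChain hvGraph.Adj ∧ b.Nodup ∧ b.length ≤ N + 1 ∧ (∀ hne : b ≠ [], (b.head hne).1 = 0) ∧ InLev T b ∧ IsHBridge b ∧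
      b ≠ [] ∧ hdLev b = c ∧ ltLev b = e := by
  rw [HB0, mem_filter, mem_hBridgesN_iff] at hb
  obtain ⟨⟨hc, hnd, hlen, ⟨v, hv, hv0⟩, hin, hB⟩, hhd, hlt⟩ := hb
  refine ⟨hc, hnd, hlen, fun hne => ?_, hin, hB, hB.1, hhd, hlt⟩
  rw [List.head?_eq_some_head hne, Option.some_inj] at hv
  rw [hv]; exact hv0

/-- Level matching in the `lev (getLast) = lev (head)` form (plumbing). [cite: DuminilCopinSmirnov2012, §3; lane plumbing] -/
theorem lev_getLast_eq_lev_head_of {p q : List HV} {c : ℤ} (hp : ltLev p = c) (hq : hdLev q = c) (hpn : p ≠ []) (hqn : q ≠ []) :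
    lev (p.getLast hpn) = lev (q.head hqn) := by
  rw [ltLev, List.getLast?_eq_some_getLast hpn, Option.getD_some] at hp
  rw [hdLev, List.head?_eq_some_head hqn, Option.getD_some] at hq
  rw [hp, hq]

set_option maxHeartbeats 400000 in
/-- ★★ **Gluing a head, a middle bridge and a tail gives a walk whose renewal split returns the three pieces.**  For `h ∈ headN T N c`,
`b ∈ HB0 T N' c e`, `g ∈ tailN T N e`: `ω = glue3 h b g` is a self-avoiding lattice chain of `S_T` from the origin to the top level with
`|ω| + 2 = |h| + |b| + |g|` vertices, it HAS a renewal index, and `fstP ω = h`, `midPc ω = b`, `tailPc ω = g`.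
[cite: DuminilCopinHammond2013, §2.2 (concatenation at renewal points; unique decomposition); lane «pcv-sawmu» a-p2 g20] -/
theorem glue3_spec (hh : h ∈ headN T N c) (hb : b ∈ HB0 T N' c e) (hg : g ∈ tailN T N e) :
    (glue3 h b g).IsChain hvGraph.Adj ∧ (glue3 h b g).Nodup ∧ InLev T (glue3 h b g) ∧ (glue3 h b g).head? = some hvOrigin ∧
      ltLev (glue3 h b g) = 2 * (T : ℤ) - 1 ∧ (glue3 h b g).length + 2 = h.length + b.length + g.length ∧
      (renIdxs (glue3 h b g)).Nonempty ∧ fstP (glue3 h b g) = h ∧ midPc (glue3 h b g) = b ∧ tailPc (glue3 h b g) = g := by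
  obtain ⟨hhc, hhn, -, hhd, hhin, hh2, hhR, hhren, hhlt, hh0⟩ := of_mem_headN hh
  obtain ⟨hbc, hbn, -, hb0, hbin, hbB, hbne, hbhd, hblt⟩ := of_mem_HB0 hb
  obtain ⟨hgc, hgn, -, hg0, hgin, hg2, hgL, hgren, hghd, hglt⟩ := of_mem_tailN hg
  have hhne : h ≠ [] := List.ne_nil_of_length_pos (by omega)
  have hgne : g ≠ [] := List.ne_nil_of_length_pos (by omega)
  -- no renewal index of `h` or `g`
  have hnoh : ∀ j, ¬ IsRenewalIdx h j := fun j hj => by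
    have : j ∈ renIdxs h := mem_filter.2 ⟨mem_range.2 (by have := hj.2.1; omega), hj⟩
    rw [hhren] at this; simp at this
  have hnog : ∀ j, ¬ IsRenewalIdx g j := fun j hj => by
    have : j ∈ renIdxs g := mem_filter.2 ⟨mem_range.2 (by have := hj.2.1; omega), hj⟩
    rw [hgren] at this; simp at this
  rcases Nat.lt_or_ge b.length 2 with hb1 | hb2
  · ------------------------------------------------------------------ trivial middle piece: `ω = hcat h g`
    obtain ⟨v, rfl⟩ : ∃ v, b = [v] := List.length_eq_one_iff.1 (by have := List.length_pos_of_ne_nil hbne; omega)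
    have hce : c = e := by rw [← hbhd, ← hblt]; rfl
    have h1 : hcat h [v] = h := by rw [hcat]; simp
    have hω : glue3 h [v] g = hcat h g := by rw [glue3, h1]
    rw [hω]
    have hlev : ∀ (hp : h ≠ []) (hq : g ≠ []), lev (h.getLast hp) = lev (g.head hq) :=
      fun hp hq => lev_getLast_eq_lev_head_of hhlt (hce ▸ hghd) hp hq
    obtain ⟨hlen, htake, hdrop, hren, hhead, hlast, hchain, hnodup, hinlev⟩ := glue_spec (T := T) hhR hh2 hgL hg2 hg0 hlev
    have hriff := isRenewalIdx_hcat_iff hhR hh2 hgL hg2 hg0 hlev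
    have hrne : (renIdxs (hcat h g)).Nonempty := ⟨h.length - 1, mem_filter.2 ⟨mem_range.2 (by rw [hlen]; omega), hren⟩⟩
    have honly : ∀ j, IsRenewalIdx (hcat h g) j → j = h.length - 1 := by
      intro j hj
      rcases (hriff j).1 hj with ⟨-, h'⟩ | h' | ⟨-, h'⟩
      · exact absurd h' (hnoh j)
      · exact h'
      · exact absurd h' (hnog _)
    have hf : fIdx (hcat h g) = h.length - 1 := honly _ (fIdx_spec hrne).1
    have hl : lIdx (hcat h g) = h.length - 1 := honly _ (lIdx_spec hrne).1
    refine ⟨hchain hhc hgc, hnodup hhn hgn, hinlev hhin hgin, by rw [hhead, hhd], by rw [(hdLev_ltLev_hcat hhR hh2 hgL hg2 hg0 hlev).2, hglt],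
      by rw [hlen]; simp; omega, hrne, ?_, ?_, ?_⟩
    · rw [fstP, hf, show h.length - 1 + 1 = h.length by omega, htake]
    · rw [midPc, hl, hf, show h.length - 1 + 1 = h.length by omega, htake, List.drop_length_sub_one hhne]
      -- `xstd [last h] = [v]`
      have hv0 : v.1 = 0 := hb0 (List.cons_ne_nil _ _)
      have hlv : lev (h.getLast hhne) = lev v := by
        have := lev_getLast_eq_lev_head_of hhlt hbhd hhne (List.cons_ne_nil v [])
        simpa using this
      have h2 := snd_eq_of_lev_eq hlv
      obtain ⟨a, x₁, bb⟩ := v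
      simp only at hv0 h2
      subst hv0
      simp [xstd, h2]
    · rw [tailPc, hl, hdrop, xstd_map_shift, xstd_eq_self_of_head (List.head?_eq_some_head hgne) (hg0 hgne)]
  · ------------------------------------------------------------------ a genuine middle bridge
    obtain ⟨hbL, hbR⟩ := isHBridge_iff_isLMin_and_isRMax.1 hbB
    have hlev1 : ∀ (hp : h ≠ []) (hq : b ≠ []), lev (h.getLast hp) = lev (b.head hq) :=
      fun hp hq => lev_getLast_eq_lev_head_of hhlt hbhd hp hq
    obtain ⟨hlen1, htake1, hdrop1, hren1, hhead1, -, hchain1, hnodup1, hinlev1⟩ := glue_spec (T := T) hhR hh2 hbL hb2 hb0 hlev1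
    have hriff1 := isRenewalIdx_hcat_iff hhR hh2 hbL hb2 hb0 hlev1
    have hR1 : IsRMax (hcat h b) := isRMax_glue hhR hh2 hbL hbR hb2 hb0 hlev1
    obtain ⟨-, hlt1⟩ := hdLev_ltLev_hcat hhR hh2 hbL hb2 hb0 hlev1
    have hp2 : 2 ≤ (hcat h b).length := by rw [hlen1]; omega
    have hpne : hcat h b ≠ [] := List.ne_nil_of_length_pos (by omega)
    have hlev2 : ∀ (hp : hcat h b ≠ []) (hq : g ≠ []), lev ((hcat h b).getLast hp) = lev (g.head hq) :=
      fun hp hq => lev_getLast_eq_lev_head_of (hlt1.trans hblt) hghd hp hq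
    obtain ⟨hlen2, htake2, hdrop2, hren2, hhead2, -, hchain2, hnodup2, hinlev2⟩ := glue_spec (T := T) hR1 hp2 hgL hg2 hg0 hlev2
    have hriff2 := isRenewalIdx_hcat_iff hR1 hp2 hgL hg2 hg0 hlev2
    rw [glue3]
    set ω := hcat (hcat h b) g with hω
    set P := hcat h b with hP
    -- the renewal indices of `ω` lie in `[|h| − 1, |P| − 1]`, both ends included
    have hrenh : IsRenewalIdx ω (h.length - 1) := (hriff2 _).2 (Or.inl ⟨by rw [hlen1]; omega, hren1⟩)
    have hbounds : ∀ j, IsRenewalIdx ω j → h.length - 1 ≤ j ∧ j ≤ P.length - 1 := by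
      intro j hj
      rcases (hriff2 j).1 hj with ⟨hjP, hj1⟩ | hj1 | ⟨-, hj1⟩
      · rcases (hriff1 j).1 hj1 with ⟨-, hj2⟩ | hj2 | ⟨hj2, -⟩
        · exact absurd hj2 (hnoh j)
        · exact ⟨by omega, by omega⟩
        · exact ⟨by omega, by omega⟩
      · exact ⟨by rw [hj1, hlen1]; omega, by omega⟩
      · exact absurd hj1 (hnog _)
    have hrne : (renIdxs ω).Nonempty := ⟨h.length - 1, mem_filter.2 ⟨mem_range.2 (by rw [hlen2, hlen1]; omega), hrenh⟩⟩
    have hf : fIdx ω = h.length - 1 := by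
      have a := (fIdx_spec hrne).2 _ hrenh
      have b' := (hbounds _ (fIdx_spec hrne).1).1
      omega
    have hl : lIdx ω = P.length - 1 := by
      have a := (lIdx_spec hrne).2 _ hren2
      have b' := (hbounds _ (lIdx_spec hrne).1).2
      omega
    refine ⟨hchain2 (hchain1 hhc hbc) hgc, hnodup2 (hnodup1 hhn hbn) hgn, hinlev2 (hinlev1 hhin hbin) hgin,
      by rw [hhead2, hhead1, hhd], by rw [(hdLev_ltLev_hcat hR1 hp2 hgL hg2 hg0 hlev2).2, hglt], by rw [hlen2, hlen1]; omega,
      hrne, ?_, ?_, ?_⟩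
    · rw [fstP, hf, show h.length - 1 + 1 = h.length by omega]
      have : ω.take h.length = (ω.take P.length).take h.length := by rw [List.take_take, Nat.min_eq_left (by rw [hlen1]; omega)]
      rw [this, htake2, htake1]
    · rw [midPc, hl, hf, show P.length - 1 + 1 = P.length by omega, htake2, hdrop1, xstd_map_shift,
        xstd_eq_self_of_head (List.head?_eq_some_head hbne) (hb0 hbne)]
    · rw [tailPc, hl, hdrop2, xstd_map_shift, xstd_eq_self_of_head (List.head?_eq_some_head hgne) (hg0 hgne)]

/-- A self-avoiding lattice chain of `S_T` from the origin ending on the top level with at most `L + 1` vertices is a β-walk of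
`S_{T,L}` (the first coordinate moves by at most one per step). [cite: DuminilCopinSmirnov2012, §3 (S_{T,L}: −L − x₁ − b ≤ x₀ ≤ L); lane plumbing] -/
theorem mem_bridgeLists_of_inLev (hT : 1 ≤ T) {l : List HV} (hc : l.IsChain hvGraph.Adj) (hhd : l.head? = some hvOrigin) (hnd : l.Nodup)
    (hin : InLev T l) (hlt : ltLev l = 2 * (T : ℤ) - 1) (hL : l.length ≤ L + 1) : l ∈ bridgeLists T L := by
  have hne : l ≠ [] := by rintro rfl; simp at hhd
  rw [mem_bridgeLists_iff hT]
  refine ⟨hc, hhd, hnd, fun v hv => ?_, hne, ?_⟩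
  · obtain ⟨k, hk, rfl⟩ := List.mem_iff_getElem.1 hv
    have h0 : l[0]'(by omega) = hvOrigin := by rw [← List.head_eq_getElem hne, List.head_eq_iff_head?_eq_some]; exact hhd
    have hdist := abs_fst_sub_le hc (Nat.zero_le k) hk
    rw [h0, abs_le] at hdist
    simp only [hvOrigin, sub_zero, Nat.cast_zero] at hdist
    have hlv := hin _ (List.getElem_mem hk)
    rcases hvk : l[k] with ⟨x₀, x₁, bb⟩
    rw [hvk] at hdist hlv
    rw [mem_stripV_iff]
    cases bb <;> simp [bit] at hlv hdist ⊢ <;> omega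
  · rw [ltLev, List.getLast?_eq_some_getLast hne, Option.getD_some] at hlt
    exact hlt

/-- ★ The glued walk is a β-walk of `S_{T,L}` with a renewal index, for every `L` with `2N + N' ≤ L`.
[cite: DuminilCopinSmirnov2012, §3; DuminilCopinHammond2013, §2.2; lane «pcv-sawmu» a-p2 g20] -/
theorem glue3_mem_renA (hT : 1 ≤ T) (hh : h ∈ headN T N c) (hb : b ∈ HB0 T N' c e) (hg : g ∈ tailN T N e) (hL : 2 * N + N' ≤ L) :
    glue3 h b g ∈ renA T L := by
  obtain ⟨hc, hnd, hin, hhd, hlt, hlen, hrne, -⟩ := glue3_spec hh hb hg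
  obtain ⟨-, -, hhl, -⟩ := of_mem_headN hh
  obtain ⟨-, -, hbl, -⟩ := of_mem_HB0 hb
  obtain ⟨-, -, hgl, -⟩ := of_mem_tailN hg
  rw [renA, mem_filter]
  exact ⟨mem_bridgeLists_of_inLev hT hc hhd hnd hin hlt (by omega), hrne⟩

end Glue3


/-! ### §6 The coefficient inequalities of the renewal split, type by type -/

section Coefficients

variable {T : ℕ}

/-- `f^{(N)}_c(i) = Σ x_c^{|h|}` over the heads `h ∈ headN T N c` with exactly `i` surface contacts. [cite: BeatonBousquetMelouDeGierDuminilCopinGuttmann2014, §3.2 (the surface fugacity y counts contacts with the top wall); lane «pcv-sawmu» a-p2 g20] -/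
def headCoeffN (T N i : ℕ) (c : ℤ) : ℝ :=
  ∑ h ∈ (headN T N c).filter (fun h => topCnt T h = i), hexCriticalFugacity ^ h.length

/-- `d⁰^{(N)}_{ce}(j) = Σ x_c^{|b|−1}` over the middle pieces `b ∈ HB0 T N c e` with exactly `j` contacts off the start vertex (`= hbCoeffN`
plus the trivial bridge when `c = e`, `j = 0`). [cite: DuminilCopinHammond2013, §2.2; BeatonBousquetMelouDeGierDuminilCopinGuttmann2014, §3.2; lane «pcv-sawmu» a-p2 g20] -/
def hb0CoeffN (T N j : ℕ) (c e : ℤ) : ℝ :=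
  ∑ b ∈ (HB0 T N c e).filter (fun b => topCnt T b.tail = j), hexCriticalFugacity ^ (b.length - 1)

/-- `g^{(N)}_e(k) = Σ x_c^{|g|−1}` over the tails `g ∈ tailN T N e` with exactly `k` contacts off the start vertex.
[cite: BeatonBousquetMelouDeGierDuminilCopinGuttmann2014, §3.2; lane «pcv-sawmu» a-p2 g20] -/
def tailCoeffN (T N k : ℕ) (e : ℤ) : ℝ :=
  ∑ g ∈ (tailN T N e).filter (fun g => topCnt T g.tail = k), hexCriticalFugacity ^ (g.length - 1)

/-- The TYPE of a walk with a renewal index: (level of the first renewal vertex, level of the last renewal vertex, contacts of the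
head, contacts of the middle bridge off its start, contacts of the tail off its start). [cite: DuminilCopinHammond2013, §2.2; lane plumbing] -/
def rtype (T : ℕ) (l : List HV) : ℤ × ℤ × ℕ × ℕ × ℕ :=
  (ltLev (fstP l), hdLev (tailPc l), topCnt T (fstP l), topCnt T (midPc l).tail, topCnt T (tailPc l).tail)

/-- `a_L(θ) = Σ x_c^{|ω|}` over the β-walks of `S_{T,L}` with a renewal index and type `θ`. [cite: BeatonBousquetMelouDeGierDuminilCopinGuttmann2014, §3.2 (β_{T,L,m}); lane «pcv-sawmu» a-p2 g20] -/
def renACoeff (T L : ℕ) (θ : ℤ × ℤ × ℕ × ℕ × ℕ) : ℝ :=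
  ∑ l ∈ (renA T L).filter (fun l => rtype T l = θ), hexCriticalFugacity ^ l.length

/-- The weight of a triple (head, middle, tail): `x_c^{|h|} · x_c^{|b|−1} · x_c^{|g|−1}` (plumbing). [folklore] -/
def tripleX (t : List HV × List HV × List HV) : ℝ :=
  hexCriticalFugacity ^ t.1.length * (hexCriticalFugacity ^ (t.2.1.length - 1) * hexCriticalFugacity ^ (t.2.2.length - 1))

/-- The product of three class sums is the sum of `tripleX` over the product class (plumbing). [cite: DuminilCopinHammond2013, §2.2; lane plumbing] -/
theorem prod_sum_eq_sum_tripleX (A B C : Finset (List HV)) :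
    (∑ h ∈ A, hexCriticalFugacity ^ h.length) * (∑ b ∈ B, hexCriticalFugacity ^ (b.length - 1)) *
      (∑ g ∈ C, hexCriticalFugacity ^ (g.length - 1)) = ∑ t ∈ A ×ˢ (B ×ˢ C), tripleX t := by
  rw [mul_assoc, sum_mul_sum B C, sum_mul_sum A B, sum_product]
  refine sum_congr rfl fun h _ => ?_
  rw [sum_product]
  refine sum_congr rfl fun b _ => ?_
  rw [mul_sum]
  refine sum_congr rfl fun g _ => ?_
  simp only [tripleX]

/-- The product of the three class coefficient sums as a sum over triples (plumbing). [cite: DuminilCopinHammond2013, §2.2; lane plumbing] -/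
theorem prod_coeff_eq_sum_tripleX (N₁ N₂ N₃ i j k : ℕ) (c e : ℤ) :
    headCoeffN T N₁ i c * hb0CoeffN T N₂ j c e * tailCoeffN T N₃ k e =
      ∑ t ∈ (headN T N₁ c).filter (fun h => topCnt T h = i) ×ˢ
        ((HB0 T N₂ c e).filter (fun b => topCnt T b.tail = j) ×ˢ (tailN T N₃ e).filter (fun g => topCnt T g.tail = k)), tripleX t :=
  prod_sum_eq_sum_tripleX _ _ _

variable {L N N' : ℕ}

/-- ★ **Upper inequality, type by type**: every β-walk of `S_{T,L}` with a renewal index and type `(c,e,i,j,k)` splits injectively into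
a head of `headN T N c` with `i` contacts, a middle piece of `HB0 T N c e` with `j` contacts and a tail of `tailN T N e` with `k` contacts
(`N + 1 ≥ |V(S_{T,L})|`), weights multiplying: `a_L(c,e,i,j,k) ≤ f^{(N)}_c(i) · d⁰^{(N)}_{ce}(j) · g^{(N)}_e(k)`.
[cite: DuminilCopinHammond2013, §2.2; BeatonBousquetMelouDeGierDuminilCopinGuttmann2014, §3.2; lane «pcv-sawmu» a-p2 g20 — own] -/
theorem renACoeff_le_prod (hT : 1 ≤ T) (hN : (stripV T L).card ≤ N + 1) (c e : ℤ) (i j k : ℕ) :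
    renACoeff T L (c, e, i, j, k) ≤ headCoeffN T N i c * hb0CoeffN T N j c e * tailCoeffN T N k e := by
  classical
  have hx := hexCriticalFugacity_pos_lt_one
  set F := (renA T L).filter (fun l => rtype T l = (c, e, i, j, k)) with hF
  have hmem : ∀ l ∈ F, l ∈ renA T L ∧ (renIdxs l).Nonempty ∧ l.length ≤ N + 1 ∧ rtype T l = (c, e, i, j, k) := by
    intro l hl
    rw [hF, mem_filter] at hl
    have h1 := hl.1
    rw [renA, mem_filter] at h1
    exact ⟨hl.1, h1.2, (length_le_card_stripV hT h1.1).trans hN, hl.2⟩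
  rw [prod_coeff_eq_sum_tripleX, renACoeff, ← hF]
  calc ∑ l ∈ F, hexCriticalFugacity ^ l.length = ∑ l ∈ F, tripleX (fstP l, midPc l, tailPc l) := by
        refine sum_congr rfl fun l hl => ?_
        obtain ⟨-, hne, -, -⟩ := hmem l hl
        simp only [tripleX]
        rw [(length_topCnt_threePieces hne T).1, pow_add, pow_add, mul_assoc]
    _ = ∑ t ∈ F.image (fun l => (fstP l, midPc l, tailPc l)), tripleX t := by
        rw [sum_image]
        intro l hl l' hl' heq
        exact threePieces_injOn (hmem l hl).2.1 (hmem l' hl').2.1 heq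
    _ ≤ _ := by
        refine sum_le_sum_of_subset_of_nonneg (fun t ht => ?_) fun t _ _ => by
          unfold tripleX; exact mul_nonneg (pow_nonneg hx.1.le _) (mul_nonneg (pow_nonneg hx.1.le _) (pow_nonneg hx.1.le _))
        rw [mem_image] at ht
        obtain ⟨l, hl, rfl⟩ := ht
        obtain ⟨hren, hne, hlen, htyp⟩ := hmem l hl
        simp only [rtype, Prod.mk.injEq] at htyp
        obtain ⟨h1, h2, h3, h4, h5⟩ := htyp
        obtain ⟨hl1, hl2, -⟩ := threePieces_levels hne
        rw [mem_product, mem_product, mem_filter, mem_filter, mem_filter]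
        refine ⟨⟨?_, h3⟩, ⟨?_, h4⟩, ⟨?_, h5⟩⟩
        · rw [← h1]; exact fstP_mem_headN hT hren hlen
        · rw [← h1, ← h2, hl1, ← hl2]; exact midPc_mem_HB0 hT hren hlen
        · rw [← h2]; exact tailPc_mem_tailN hT hren hlen

/-- ★ **Lower inequality, type by type**: gluing is injective on `headN T N c × HB0 T N' c e × tailN T N e` and lands in the β-walks of
`S_{T,L}` with a renewal index and the corresponding type whenever `2N + N' ≤ L`:
`f^{(N)}_c(i) · d⁰^{(N')}_{ce}(j) · g^{(N)}_e(k) ≤ a_L(c,e,i,j,k)`. [cite: DuminilCopinHammond2013, §2.2; BeatonBousquetMelouDeGierDuminilCopinGuttmann2014, §3.2; lane «pcv-sawmu» a-p2 g20 — own] -/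
theorem prod_le_renACoeff (hT : 1 ≤ T) (hL : 2 * N + N' ≤ L) (c e : ℤ) (i j k : ℕ) :
    headCoeffN T N i c * hb0CoeffN T N' j c e * tailCoeffN T N k e ≤ renACoeff T L (c, e, i, j, k) := by
  classical
  have hx := hexCriticalFugacity_pos_lt_one
  set A := (headN T N c).filter (fun h => topCnt T h = i) with hA
  set B := (HB0 T N' c e).filter (fun b => topCnt T b.tail = j) with hB
  set C := (tailN T N e).filter (fun g => topCnt T g.tail = k) with hC
  have hmem : ∀ t ∈ A ×ˢ (B ×ˢ C), t.1 ∈ headN T N c ∧ t.2.1 ∈ HB0 T N' c e ∧ t.2.2 ∈ tailN T N e ∧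
      topCnt T t.1 = i ∧ topCnt T t.2.1.tail = j ∧ topCnt T t.2.2.tail = k := by
    intro t ht
    rw [mem_product, mem_product, hA, hB, hC, mem_filter, mem_filter, mem_filter] at ht
    exact ⟨ht.1.1, ht.2.1.1, ht.2.2.1, ht.1.2, ht.2.1.2, ht.2.2.2⟩
  rw [prod_coeff_eq_sum_tripleX, ← hA, ← hB, ← hC, renACoeff]
  calc ∑ t ∈ A ×ˢ (B ×ˢ C), tripleX t = ∑ t ∈ A ×ˢ (B ×ˢ C), hexCriticalFugacity ^ (glue3 t.1 t.2.1 t.2.2).length := by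
        refine sum_congr rfl fun t ht => ?_
        obtain ⟨h1, h2, h3, -⟩ := hmem t ht
        obtain ⟨-, -, -, -, -, hlen, -⟩ := glue3_spec h1 h2 h3
        obtain ⟨-, -, -, -, -, -, hbne, -⟩ := of_mem_HB0 h2
        obtain ⟨-, -, -, -, -, hg2, -⟩ := of_mem_tailN h3
        have hb1 := List.length_pos_of_ne_nil hbne
        rw [tripleX, ← pow_add, ← pow_add]
        congr 1; omega
    _ = ∑ l ∈ (A ×ˢ (B ×ˢ C)).image (fun t => glue3 t.1 t.2.1 t.2.2), hexCriticalFugacity ^ l.length := by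
        rw [sum_image]
        rintro ⟨th, tb, tg⟩ ht ⟨th', tb', tg'⟩ ht' heq
        obtain ⟨h1, h2, h3, -⟩ := hmem _ ht
        obtain ⟨h1', h2', h3', -⟩ := hmem _ ht'
        obtain ⟨-, -, -, -, -, -, -, e1, e2, e3⟩ := glue3_spec h1 h2 h3
        obtain ⟨-, -, -, -, -, -, -, e1', e2', e3'⟩ := glue3_spec h1' h2' h3'
        simp only at heq e1 e2 e3 e1' e2' e3'
        rw [heq] at e1 e2 e3
        rw [← e1, ← e2, ← e3, e1', e2', e3']
    _ ≤ _ := by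
        refine sum_le_sum_of_subset_of_nonneg (fun l hl => ?_) fun l _ _ => pow_nonneg hx.1.le _
        rw [mem_image] at hl
        obtain ⟨t, ht, rfl⟩ := hl
        obtain ⟨h1, h2, h3, ti, tj, tk⟩ := hmem t ht
        obtain ⟨-, -, -, -, -, -, -, e1, e2, e3⟩ := glue3_spec h1 h2 h3
        obtain ⟨-, -, -, -, -, -, -, -, hc1, -⟩ := of_mem_headN h1
        obtain ⟨-, -, -, -, -, -, -, -, he3, -⟩ := of_mem_tailN h3
        rw [mem_filter]
        refine ⟨glue3_mem_renA hT h1 h2 h3 hL, ?_⟩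
        simp only [rtype, e1, e2, e3, hc1, he3, ti, tj, tk]

end Coefficients


/-! ### §7 Summing over types: the coefficients `β_{T,L,m}` against the renewal split -/

section Summed

variable {T : ℕ}

/-- The contact triples `(i, j, k)` with `i + j + k = m` (plumbing). [folklore] -/
def T3 (m : ℕ) : Finset (ℕ × ℕ × ℕ) := (antidiagonal m).biUnion fun p => (antidiagonal p.2).image fun q => (p.1, q.1, q.2)

/-- Membership in `T3`. [cite: DuminilCopinHammond2013, §2.2; lane plumbing] -/
theorem mem_T3 {m : ℕ} {t : ℕ × ℕ × ℕ} : t ∈ T3 m ↔ t.1 + t.2.1 + t.2.2 = m := by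
  rw [T3, mem_biUnion]
  constructor
  · rintro ⟨p, hp, ht⟩
    rw [mem_image] at ht
    obtain ⟨q, hq, rfl⟩ := ht
    rw [HasAntidiagonal.mem_antidiagonal] at hp hq
    simp only; omega
  · intro h
    refine ⟨(t.1, t.2.1 + t.2.2), HasAntidiagonal.mem_antidiagonal.2 (by simp only; omega),
      mem_image.2 ⟨(t.2.1, t.2.2), HasAntidiagonal.mem_antidiagonal.2 rfl, ?_⟩⟩
    simp

/-- Summing over `T3 m` is the nested antidiagonal sum (plumbing). [cite: DuminilCopinHammond2013, §2.2; lane plumbing] -/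
theorem sum_T3 (m : ℕ) (G : ℕ × ℕ × ℕ → ℝ) :
    ∑ t ∈ T3 m, G t = ∑ p ∈ antidiagonal m, ∑ q ∈ antidiagonal p.2, G (p.1, q.1, q.2) := by
  rw [T3, sum_biUnion]
  · refine sum_congr rfl fun p _ => ?_
    rw [sum_image]
    intro q _ q' _ h
    simp only [Prod.mk.injEq] at h
    exact Prod.ext h.2.1 h.2.2
  · intro p hp p' hp' hne
    rw [Function.onFun, disjoint_left]
    intro t ht ht'
    rw [mem_image] at ht ht'
    obtain ⟨q, hq, rfl⟩ := ht
    obtain ⟨q', hq', h⟩ := ht'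
    simp only [Prod.mk.injEq] at h
    rw [mem_coe, HasAntidiagonal.mem_antidiagonal] at hp hp'
    exact hne (Prod.ext h.1.symm (by omega))

/-- The finite set of types at total contact number `m` (plumbing). [folklore] -/
def rtypes (T m : ℕ) : Finset (ℤ × ℤ × ℕ × ℕ × ℕ) :=
  (Finset.Icc (0 : ℤ) (2 * T - 1)) ×ˢ ((Finset.Icc (0 : ℤ) (2 * T - 1)) ×ˢ T3 m)

/-- Summing over the types is the nested sum over the two levels and the two antidiagonals (plumbing). [cite: DuminilCopinHammond2013, §2.2; lane plumbing] -/
theorem sum_rtypes (T m : ℕ) (G : ℤ × ℤ × ℕ × ℕ × ℕ → ℝ) :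
    ∑ θ ∈ rtypes T m, G θ = ∑ c ∈ Finset.Icc (0 : ℤ) (2 * T - 1), ∑ e ∈ Finset.Icc (0 : ℤ) (2 * T - 1),
      ∑ p ∈ antidiagonal m, ∑ q ∈ antidiagonal p.2, G (c, e, p.1, q.1, q.2) := by
  rw [rtypes, sum_product]
  refine sum_congr rfl fun c _ => ?_
  rw [sum_product]
  refine sum_congr rfl fun e _ => ?_
  rw [sum_T3]

/-- The type of a β-walk with a renewal index and `m` contacts lies in `rtypes T m`; conversely the type determines the number of
contacts. [cite: DuminilCopinHammond2013, §2.2; BeatonBousquetMelouDeGierDuminilCopinGuttmann2014, §3.2; lane plumbing] -/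
theorem rtype_mem_rtypes (hT : 1 ≤ T) {L : ℕ} {l : List HV} (hl : l ∈ renA T L) :
    rtype T l ∈ rtypes T (topCnt T l) ∧ topCnt T l = (rtype T l).2.2.1 + (rtype T l).2.2.2.1 + (rtype T l).2.2.2.2 := by
  obtain ⟨-, -, -, -, -, -, hne, -⟩ := of_mem_renA hT hl
  obtain ⟨N, hN⟩ : ∃ N, l.length ≤ N + 1 := ⟨l.length, by omega⟩
  have h1 := fstP_mem_headN hT hl hN
  have h3 := tailPc_mem_tailN hT hl hN
  obtain ⟨-, -, -, -, hin1, -⟩ := of_mem_headN h1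
  obtain ⟨-, -, -, -, hin3, -⟩ := of_mem_tailN h3
  obtain ⟨hf0, hfl, hl1, hlen1, -, hlen3⟩ := threePieces_lengths hne
  have hne1 : fstP l ≠ [] := List.ne_nil_of_length_pos (by omega)
  have hne3 : tailPc l ≠ [] := List.ne_nil_of_length_pos (by omega)
  obtain ⟨-, b1, -, -⟩ := hdLev_ltLev_bounds hin1 hne1
  obtain ⟨b3, b4, -, -⟩ := hdLev_ltLev_bounds hin3 hne3
  obtain ⟨b0, -, -, -⟩ := hdLev_ltLev_bounds hin1 hne1
  have htop := (length_topCnt_threePieces hne T).2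
  refine ⟨?_, htop⟩
  rw [rtypes, rtype, mem_product, mem_product, Finset.mem_Icc, Finset.mem_Icc, mem_T3]
  obtain ⟨-, b1', b2', -⟩ := hdLev_ltLev_bounds hin1 hne1
  exact ⟨⟨by linarith [(hdLev_ltLev_bounds hin1 hne1).2.2.1], (hdLev_ltLev_bounds hin1 hne1).2.2.2⟩, ⟨b3, b4⟩, htop.symm⟩

/-- ★ **Fibre decomposition**: the `x_c`-weight of the β-walks of `S_{T,L}` with a renewal index and `m` contacts is the sum over
the types of `a_L(θ)`. [cite: DuminilCopinHammond2013, §2.2; BeatonBousquetMelouDeGierDuminilCopinGuttmann2014, §3.2; lane plumbing] -/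
theorem sum_renA_slice_eq_sum_rtypes (hT : 1 ≤ T) (L m : ℕ) :
    ∑ l ∈ (renA T L).filter (fun l => topCnt T l = m), hexCriticalFugacity ^ l.length = ∑ θ ∈ rtypes T m, renACoeff T L θ := by
  classical
  rw [← Finset.sum_fiberwise_of_maps_to (g := rtype T) (t := rtypes T m) (fun l hl => by
    rw [mem_filter] at hl
    rw [← hl.2]; exact (rtype_mem_rtypes hT hl.1).1)]
  refine sum_congr rfl fun θ hθ => ?_
  rw [renACoeff, filter_filter]
  refine sum_congr (filter_congr fun l hl => ⟨fun h => h.2, fun h => ⟨?_, h⟩⟩) fun _ _ => rfl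
  -- the type determines the number of contacts
  have h2 := (rtype_mem_rtypes hT hl).2
  rw [h] at h2
  rw [rtypes, mem_product, mem_product, mem_T3] at hθ
  omega

/-- ★ **Case A weighs exactly as much as case B, slice by slice** (the mirror is a bijection preserving length and contacts).
[cite: DuminilCopinSmirnov2012, §3 (Fig. 3: S_{T,L} is symmetric); lane plumbing] -/
theorem sum_caseA_slice_le_caseB (hT : 1 ≤ T) (L m : ℕ) :
    ∑ l ∈ (caseA T L).filter (fun l => topCnt T l = m), hexCriticalFugacity ^ l.length ≤
      ∑ l ∈ (caseB T L).filter (fun l => topCnt T l = m), hexCriticalFugacity ^ l.length := by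
  classical
  have hinj : Set.InjOn (fun l : List HV => l.map mirrorX) ((caseA T L).filter (fun l => topCnt T l = m) : Set (List HV)) :=
    fun l _ l' _ h => (List.map_injective_iff.2 mirrorX.injective) h
  calc ∑ l ∈ (caseA T L).filter (fun l => topCnt T l = m), hexCriticalFugacity ^ l.length
      = ∑ l ∈ (caseA T L).filter (fun l => topCnt T l = m), hexCriticalFugacity ^ (l.map mirrorX).length := by
        simp only [List.length_map]
    _ = ∑ l ∈ ((caseA T L).filter (fun l => topCnt T l = m)).image fun l => l.map mirrorX, hexCriticalFugacity ^ l.length := by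
        rw [sum_image hinj]
    _ ≤ ∑ l ∈ (caseB T L).filter (fun l => topCnt T l = m), hexCriticalFugacity ^ l.length := by
        refine sum_le_sum_of_subset_of_nonneg (fun l' hl' => ?_) fun _ _ _ => pow_nonneg hexCriticalFugacity_pos_lt_one.1.le _
        rw [mem_image] at hl'
        obtain ⟨l, hl, rfl⟩ := hl'
        rw [mem_filter, caseA, mem_filter] at hl
        rw [mem_filter, caseB, mem_filter, sIdx_map_mirrorX, tIdx_map_mirrorX, topCnt_map_mirrorX]
        exact ⟨⟨map_mirrorX_mem_bridgeLists hT hl.1.1, hl.1.2⟩, hl.2⟩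

/-- ★ `β_{T,L,m} = 2 · Σ_{case A, m contacts} x_c^{|ω|}`. [cite: BeatonBousquetMelouDeGierDuminilCopinGuttmann2014, §3.2 (β_{T,L,m}); DuminilCopinSmirnov2012, §3 (symmetry of S_{T,L}); lane plumbing] -/
theorem stripBcoeffY_eq_two_mul_caseA (hT : 1 ≤ T) (L m : ℕ) :
    stripBcoeffY T L m = 2 * ∑ l ∈ (caseA T L).filter (fun l => topCnt T l = m), hexCriticalFugacity ^ l.length := by
  classical
  rw [stripBcoeffY_eq_sum_bridgeLists hT, bridgeLists_eq_caseA_union_caseB hT, filter_union]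
  have hdisj : Disjoint ((caseA T L).filter (fun l => topCnt T l = m)) ((caseB T L).filter (fun l => topCnt T l = m)) := by
    rw [disjoint_left]
    intro l h1 h2
    rw [mem_filter, caseA, mem_filter] at h1
    rw [mem_filter, caseB, mem_filter] at h2
    omega
  rw [sum_union hdisj]
  have h1 := sum_caseA_slice_le_caseB hT L m (T := T)
  have h2 := sum_caseB_slice_le hT m (T := T) (L := L)
  linarith

/-- Case A splits into the walks without and with a renewal index, slice by slice. [cite: DuminilCopinHammond2013, §2.2; lane plumbing] -/
theorem sum_caseA_slice_eq (L m : ℕ) :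
    ∑ l ∈ (caseA T L).filter (fun l => topCnt T l = m), hexCriticalFugacity ^ l.length =
      ∑ l ∈ ((caseA T L).filter fun l => renIdxs l = ∅).filter (fun l => topCnt T l = m), hexCriticalFugacity ^ l.length +
      ∑ l ∈ (renA T L).filter (fun l => topCnt T l = m), hexCriticalFugacity ^ l.length := by
  classical
  rw [renA_eq_filter_caseA, filter_filter, filter_filter, ← sum_union]
  · refine sum_congr ?_ fun _ _ => rfl
    ext l
    simp only [mem_filter, mem_union]
    constructor
    · rintro ⟨hl, hm⟩
      by_cases h : renIdxs l = ∅
      · exact Or.inl ⟨hl, h, hm⟩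
      · exact Or.inr ⟨hl, Finset.nonempty_iff_ne_empty.2 h, hm⟩
    · rintro (⟨hl, -, hm⟩ | ⟨hl, -, hm⟩) <;> exact ⟨hl, hm⟩
  · rw [disjoint_left]
    intro l h1 h2
    rw [mem_filter] at h1 h2
    exact Finset.nonempty_iff_ne_empty.1 h2.2.1 h1.2.1

variable {L N N' : ℕ}

/-- ★★★ **THE RENEWAL SPLIT OF `β_{T,L,m}`, UPPER HALF**: for `N + 1 ≥ |V(S_{T,L})|`,
`β_{T,L,m} ≤ 2·( Σ_{ω ∈ N₀^A(S_{T,L}), m contacts} x_c^{|ω|} + Σ_{c,e} Σ_{i+j+k=m} f^{(N)}_c(i) d⁰^{(N)}_{ce}(j) g^{(N)}_e(k) )`.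
[cite: DuminilCopinHammond2013, §2.2; BeatonBousquetMelouDeGierDuminilCopinGuttmann2014, §3.2 (β_{T,L,m}); lane «pcv-sawmu» a-p2 g20 — own] -/
theorem stripBcoeffY_le_renewal (hT : 1 ≤ T) (hN : (stripV T L).card ≤ N + 1) (m : ℕ) :
    stripBcoeffY T L m ≤ 2 * (∑ l ∈ ((caseA T L).filter fun l => renIdxs l = ∅).filter (fun l => topCnt T l = m), hexCriticalFugacity ^ l.length +
      ∑ c ∈ Finset.Icc (0 : ℤ) (2 * T - 1), ∑ e ∈ Finset.Icc (0 : ℤ) (2 * T - 1), ∑ p ∈ antidiagonal m, ∑ q ∈ antidiagonal p.2,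
        headCoeffN T N p.1 c * hb0CoeffN T N q.1 c e * tailCoeffN T N q.2 e) := by
  rw [stripBcoeffY_eq_two_mul_caseA hT, sum_caseA_slice_eq, sum_renA_slice_eq_sum_rtypes hT]
  set F : ℤ × ℤ × ℕ × ℕ × ℕ → ℝ :=
    fun θ => headCoeffN T N θ.2.2.1 θ.1 * hb0CoeffN T N θ.2.2.2.1 θ.1 θ.2.1 * tailCoeffN T N θ.2.2.2.2 θ.2.1 with hF
  have key : ∑ θ ∈ rtypes T m, renACoeff T L θ ≤ ∑ θ ∈ rtypes T m, F θ := sum_le_sum fun θ _ => by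
    obtain ⟨c, e, i, j, k⟩ := θ
    simp only [hF]
    exact renACoeff_le_prod hT hN c e i j k
  have hre : ∑ θ ∈ rtypes T m, F θ = ∑ c ∈ Finset.Icc (0 : ℤ) (2 * T - 1), ∑ e ∈ Finset.Icc (0 : ℤ) (2 * T - 1),
      ∑ p ∈ antidiagonal m, ∑ q ∈ antidiagonal p.2, headCoeffN T N p.1 c * hb0CoeffN T N q.1 c e * tailCoeffN T N q.2 e := by
    rw [sum_rtypes]
  linarith

/-- ★★★ **THE RENEWAL SPLIT OF `β_{T,L,m}`, LOWER HALF**: for `2N + N' ≤ L`,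
`2 · Σ_{c,e} Σ_{i+j+k=m} f^{(N)}_c(i) d⁰^{(N')}_{ce}(j) g^{(N)}_e(k) ≤ β_{T,L,m}`.
[cite: DuminilCopinHammond2013, §2.2; BeatonBousquetMelouDeGierDuminilCopinGuttmann2014, §3.2 (β_{T,L,m}); lane «pcv-sawmu» a-p2 g20 — own] -/
theorem renewal_le_stripBcoeffY (hT : 1 ≤ T) (hL : 2 * N + N' ≤ L) (m : ℕ) :
    2 * ∑ c ∈ Finset.Icc (0 : ℤ) (2 * T - 1), ∑ e ∈ Finset.Icc (0 : ℤ) (2 * T - 1), ∑ p ∈ antidiagonal m, ∑ q ∈ antidiagonal p.2,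
        headCoeffN T N p.1 c * hb0CoeffN T N' q.1 c e * tailCoeffN T N q.2 e ≤ stripBcoeffY T L m := by
  rw [stripBcoeffY_eq_two_mul_caseA hT, sum_caseA_slice_eq, sum_renA_slice_eq_sum_rtypes hT]
  set F : ℤ × ℤ × ℕ × ℕ × ℕ → ℝ :=
    fun θ => headCoeffN T N θ.2.2.1 θ.1 * hb0CoeffN T N' θ.2.2.2.1 θ.1 θ.2.1 * tailCoeffN T N θ.2.2.2.2 θ.2.1 with hF
  have h0 : 0 ≤ ∑ l ∈ ((caseA T L).filter fun l => renIdxs l = ∅).filter (fun l => topCnt T l = m), hexCriticalFugacity ^ l.length :=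
    sum_nonneg fun _ _ => pow_nonneg hexCriticalFugacity_pos_lt_one.1.le _
  have h1 : ∑ θ ∈ rtypes T m, F θ ≤ ∑ θ ∈ rtypes T m, renACoeff T L θ := sum_le_sum fun θ _ => by
    obtain ⟨c, e, i, j, k⟩ := θ
    simp only [hF]
    exact prod_le_renACoeff hT hL c e i j k
  have hre : ∑ θ ∈ rtypes T m, F θ = ∑ c ∈ Finset.Icc (0 : ℤ) (2 * T - 1), ∑ e ∈ Finset.Icc (0 : ℤ) (2 * T - 1),
      ∑ p ∈ antidiagonal m, ∑ q ∈ antidiagonal p.2, headCoeffN T N p.1 c * hb0CoeffN T N' q.1 c e * tailCoeffN T N q.2 e := by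
    rw [sum_rtypes]
  linarith

end Summed

end HV

end Literature.Probability.RandomPlanarGeometry.SAW
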